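import Literature.MathematicalPhysics.KineticTheory.TaggedLinearBoltzmannSeries
import Literature.MathematicalPhysics.KineticTheory.LinearLorentzBoltzmannDuality
import Literature.Analysis.FluidPDE.BoltzmannEquationProofs
import HarnessLib

/-!
# A tagged hard sphere at equilibrium: the diffusion coefficient and the assembly of BGSR's
# Theorem 2.3 from its printed parts
(Bodineau–Gallagher–Saint-Raymond, Invent. Math. 203 (2016); arXiv:1305.3397v2 numbering)

`Literature/MathematicalPhysics/KineticTheory/TaggedSphereDiffusion.lean` decomposes the
Brownian-limit theorem for a tagged hard sphere (BGSR Thm 2.3, one-time position marginals;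
item (d) `Literature.MathematicalPhysics.KineticTheory.bodineau_gallagher_saintRaymond_brownian` corrected to
`bodineau_gallagher_saintRaymond_diffusive`) into the intermediate results *as printed*:
Thm 2.2 (2.9) `bgsr_linearBoltzmannApprox`, Lemma 6.1/(6.5) `bgsr_exists_diffusionCorrector`,
the positivity of `κ_β` (6.8) `bgsr_diffusionCoeff_pos`, and the hydrodynamic limit (6.3)
`bgsr_hydrodynamicLimit`. This companion file

* **proves the named fact `bgsr_diffusionCoeff_pos`** (`bgsr_diffusionCoeff_pos_holds`, Part I):
  `κ_β = d⁻¹ ∫ v · b(v) M_β(v) dv > 0` for every diffusion corrector `b` (`L b = v`), and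
* **proves the assembly step** (Part II), which the paper dispatches in two sentences of §6.1.1
  (after (6.1), the bound (2.9) at `t = ατ`: "It is therefore possible to take the limit `α → ∞`
  while conserving a small right-hand side in (6.1), as soon as `α ≪ (log log N)^{(A-1)/(2A)}`",
  and "Then (2.12) follows directly from the following result" (6.3)):
  `bodineau_gallagher_saintRaymond_diffusive_of_facts : bgsr_linearBoltzmannApprox →
  bgsr_exists_diffusionCorrector → bgsr_diffusionCoeff_pos → bgsr_hydrodynamicLimit →
  bodineau_gallagher_saintRaymond_diffusive` (with `κ = 2 κ_β`), and its three-hypothesis form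
  `bodineau_gallagher_saintRaymond_diffusive_of_facts'` using Part I. (The consistency check
  "the first-vendored (d) implies the corrected statement" is kept only as the comparison of the
  two growth hypotheses, `tendsto_div_sqrt_logLog_of_rate`: (d) itself is deprecated since
  2026-08-15 and no theorem of this file mentions it.)

## Part I: positivity of the diffusion coefficient (BGSR (6.8), §6.1.2)

BGSR use `κ_β > 0` implicitly ((2.11) is the heat equation, §6.2 identifies `κ_β` as the variance
of the limiting Brownian motion). The printed ingredients are Lemma 6.1 (`L` is self-adjoint,
Fredholm, `L = a(v) - K` on `L²(a_β M_β dv)`, after Hilbert [24]) and the definition (6.8)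
`κ_β = d⁻¹ ∫ v L⁻¹ v M_β dv`. The proof formalised here is the classical energy argument
(Cercignani–Illner–Pulvirenti 1994 §3.1 for the change of variables, §7.1–7.2 for the
symmetrised form):

1. *The collision involution* `(v, v₁, ν) ↦ (v', v₁', -ν)` of `ℝ^d × ℝ^d × S^{d-1}` preserves
   `dv dv₁ dν` (`exists_collisionInvolution`: the unit Jacobian
   `Kinetic.measurePreserving_collideSwap` of `BoltzmannEquationProofs`, the invariance of the
   surface measure under the antipodal isometry `Hilbert6.measurePreserving_restrict_sphere`, and
   `MeasurePreserving.skew_product`), leaves the weight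
   `W = ((v - v₁)·ν)₊ M_β(v) M_β(v₁)` invariant (micro-reversibility of the hard-sphere kernel and
   detailed balance `maxwellianBeta_collide_mul`) and exchanges `v` and `v'`.
2. *Tonelli*: for `g ∈ L²(a_β M_β dv)` the functions `W g(v)²` and `W g(v')²` are integrable on
   the triple product, with `∫∫∫ W g(v)² = ∫ g² a_β M_β` (`integrable_collisionWeight_mul_sq`).
3. *Weak form*: for `g, h ∈ L²(a_β M_β)`, `∫ (L g) h M_β = ∫∫∫ W (g(v) - g(v')) h(v)` by Fubini
   (`integral_linearBoltzmannOp_mul`; the iterated Bochner integrals defining `L g` are exactly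
   the inner integrals delivered by Fubini, so no pointwise convergence of `L g` is needed), and by
   the involution `2 ∫∫∫ W (g - g') h = ∫∫∫ W (g - g')(h - h')`
   (`two_mul_integral_collisionForm`): the Dirichlet form of `L` is symmetric and nonnegative.
4. *Cauchy–Schwarz* for this form (`sq_integral_collisionForm_le`, discriminant argument).
5. For a corrector, `L bᵢ = vᵢ` a.e., and `bᵢ, vᵢ ∈ L²(a_β M_β)` (`a_β` grows linearly,
   `collisionFrequency_le`; Gaussian moments). Hence `2 ∫ vᵢ bᵢ M_β = ½ ∫∫∫ W (bᵢ - bᵢ')² ≥ 0` and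
   `2 ∫ vᵢ² M_β = ½ ∫∫∫ W (bᵢ - bᵢ')(vᵢ - vᵢ')`; if the former vanished, Cauchy–Schwarz would
   give `∫ vᵢ² M_β = 0`, which is absurd (`integral_sq_apply_mul_maxwellianBeta_pos`). Summing
   over `i` (`⟪v, b⟫ = ∑ vᵢ bᵢ`), `κ_β > 0` (`bgsr_diffusionCoeff_pos_holds`).

## Part II: the assembly

1. *The law as a density*: `∫ φ dLaw(x_1(t)) = ∫∫ f_N^{(1)}(t, x, v) φ(x) dx dv`
   (`integral_taggedPositionLaw_eq`), from the sibling file `TaggedSphereLinearBoltzmann`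
   (`integral_taggedLaw_eq_integral_bgsrTaggedMarginal`: the tagged law is `f_N^{(1)} dx dv`,
   BGSR (2.10)), which also provides the maximum-principle bound `f_N^{(1)} ≤ ‖ρ⁰‖_∞ M_β`
   (BGSR Prop. 4.1, `bgsrTaggedMarginal_le`) and dominated convergence with a Maxwellian
   majorant (`tendsto_integral_mul_of_maxwellian_dominated`).
2. *Uniform closeness*: along an admissible sequence (`α_k → ∞`,
   `α_k / (log log (N_k+1))^{(A-1)/(2A)} → 0`, whence `N_k → ∞`,
   `tendsto_natCast_of_tendsto_alpha`) the right-hand side of (2.9) at `t = α_k τ` tends to `0`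
   (`tendsto_bgsrRate`; this is (6.1)), so (2.9) (an `L^∞` bound, `ae_abs_le_of_eLpNorm_top_le`)
   and (6.3) give, for every `e > 0`, eventually `|f^{(1)}(α_k τ, x, v) - M_β(v) ρ(τ, x)| ≤ e`
   for a.e. `(x, v)`, `ρ(τ) = G_{2κ_β τ} * ρ⁰` the heat flow (`torusHeatSolution`).
3. *The limit*: `∫∫ φ(x) M_β(v) ρ(τ, x) dv dx = ∫ φ ρ(τ)` (`∫ M_β = 1`)
   `= ∫ ρ⁰(x) 𝔼[φ(x + proj (√(2 κ_β τ) Z))] dx` (`integral_mul_torusHeatSolution`, symmetry of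
   the wrapped heat kernel by translation invariance on `T^d` and Fubini).
4. *The two growth hypotheses compared*: `log log (N+1) ≤ log log N + 1` and
   `(A-1)/(2A) < 1/2` give `α_k / √(log log N_k) → 0` (the hypothesis of the deprecated first
   rendering (d)) from `α_k / (log log (N_k+1))^{(A-1)/(2A)} → 0` (the printed one)
   (`tendsto_div_sqrt_logLog_of_rate`), i.e. the correction only strengthens the hypothesis.

## References

* T. Bodineau, I. Gallagher, L. Saint-Raymond, *The Brownian motion as the limit of a
  deterministic system of hard-spheres*, Invent. Math. 203 (2016) 493–553 = arXiv:1305.3397v2,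
  Thm 2.2 (2.9), Thm 2.3 (2.11)–(2.12), §6.1.1 (6.1), (6.3), §6.1.2 (Lemma 6.1, (6.5), (6.8)),
  §6.2 Step 2.
* C. Cercignani, R. Illner, M. Pulvirenti, *The Mathematical Theory of Dilute Gases*, Springer
  (1994), §3.1 (collision change of variables, p. 35), §7.1–7.2 (symmetrised forms).
-/

open MeasureTheory Metric Set Filter Topology ProbabilityTheory
open scoped InnerProductSpace ENNReal

namespace Literature.MathematicalPhysics.KineticTheory

noncomputable section

variable {d : Type*} [Fintype d]

/-! # Part I. Positivity of the diffusion coefficient `κ_β` -/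

/-! ## The collision involution `(v, v₁, ν) ↦ (v', v₁', -ν)` -/

section Involution

/-- The collision law only depends on `±ν`: `collide (-ν) = collide ν`. [folklore] -/
theorem collide_neg_sphere (ν : sphere (0 : EuclideanSpace ℝ d) 1)
    (p : EuclideanSpace ℝ d × EuclideanSpace ℝ d) : collide (-ν) p = collide ν p := by
  simp only [collide, coe_neg_sphere, inner_neg_right, neg_smul, smul_neg, neg_neg]

/-- For a fixed impact direction the collision law preserves Lebesgue measure on
`ℝ^d × ℝ^d` (a linear involution). [folklore] -/
theorem measurePreserving_collide (ν : sphere (0 : EuclideanSpace ℝ d) 1) :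
    MeasurePreserving (collide ν)
      (volume : Measure (EuclideanSpace ℝ d × EuclideanSpace ℝ d)) volume := by
  have h1 := Literature.Analysis.FluidPDE.measurePreserving_collideSwap (E := EuclideanSpace ℝ d) ν
  have h2 : MeasurePreserving (Prod.swap : EuclideanSpace ℝ d × EuclideanSpace ℝ d →
      EuclideanSpace ℝ d × EuclideanSpace ℝ d) ((volume : Measure (EuclideanSpace ℝ d)).prod volume)
      ((volume : Measure (EuclideanSpace ℝ d)).prod volume) := Measure.measurePreserving_swap
  have h3 := h2.comp h1
  have hfun : (Prod.swap ∘ fun p : EuclideanSpace ℝ d × EuclideanSpace ℝ d => (collide ν p).swap) =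
      collide ν := funext fun p => Prod.swap_swap _
  rw [hfun] at h3
  exact h3

/-- **The collision involution.** On `(ℝ^d × ℝ^d) × S^{d-1} ∋ ((v, v₁), ν)` the map
`(v, v₁, ν) ↦ (v', v₁', -ν)` is a measurable involution preserving `dv dv₁ dν` (unit Jacobian of
the collision change of variables, CIP 1994 §3.1, and invariance of the surface measure under the
antipodal map); packaged as a `MeasurableEquiv` given existentially. [cite: CIP1994, §3.1 p. 35] -/
theorem exists_collisionInvolution :
    ∃ e : (EuclideanSpace ℝ d × EuclideanSpace ℝ d) × sphere (0 : EuclideanSpace ℝ d) 1 ≃ᵐ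
        (EuclideanSpace ℝ d × EuclideanSpace ℝ d) × sphere (0 : EuclideanSpace ℝ d) 1,
      (∀ q, e q = (collide q.2 q.1, -q.2)) ∧
      MeasurePreserving e
        ((volume : Measure (EuclideanSpace ℝ d × EuclideanSpace ℝ d)).prod sphereMeasure)
        ((volume : Measure (EuclideanSpace ℝ d × EuclideanSpace ℝ d)).prod sphereMeasure) := by
  -- the antipodal map of the sphere, as the restriction of the linear isometry `-id`
  set A : EuclideanSpace ℝ d ≃ₗᵢ[ℝ] EuclideanSpace ℝ d := LinearIsometryEquiv.neg ℝ with hA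
  set f₀ := (mapsTo_sphere_linearIsometryEquiv A).restrict A (sphere (0 : EuclideanSpace ℝ d) 1)
    (sphere (0 : EuclideanSpace ℝ d) 1) with hf₀
  have hf₀_apply : ∀ ν, f₀ ν = -ν := fun ν =>
    Subtype.ext (by simp [hf₀, MapsTo.val_restrict_apply, hA])
  have hf₀_mp : MeasurePreserving f₀ sphereMeasure sphereMeasure :=
    measurePreserving_restrict_sphere A
  -- the skew product `(ν, p) ↦ (-ν, collide ν p)` on `S^{d-1} × (ℝ^d × ℝ^d)`
  set Θ' : sphere (0 : EuclideanSpace ℝ d) 1 × (EuclideanSpace ℝ d × EuclideanSpace ℝ d) →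
      sphere (0 : EuclideanSpace ℝ d) 1 × (EuclideanSpace ℝ d × EuclideanSpace ℝ d) :=
    fun r => (-r.1, collide r.1 r.2) with hΘ'
  have hΘ'_cont : Continuous Θ' :=
    (continuous_neg.comp continuous_fst).prodMk
      (Literature.Analysis.FluidPDE.continuous_collide_uncurry.comp (continuous_snd.prodMk continuous_fst))
  have hΘ'_invol : ∀ r, Θ' (Θ' r) = r := fun r => by
    simp only [hΘ', neg_neg, collide_neg_sphere, collide_collide]
  have hΘ'_mp : MeasurePreserving Θ' (sphereMeasure.prod volume) (sphereMeasure.prod volume) := by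
    have hskew := MeasurePreserving.skew_product (μa := sphereMeasure) (μb := sphereMeasure)
      (μc := (volume : Measure (EuclideanSpace ℝ d × EuclideanSpace ℝ d)))
      (μd := (volume : Measure (EuclideanSpace ℝ d × EuclideanSpace ℝ d))) (f := f₀) hf₀_mp
      (g := fun ν p => collide ν p)
      (Literature.Analysis.FluidPDE.continuous_collide_uncurry.comp (continuous_snd.prodMk continuous_fst)).measurable
      (Eventually.of_forall fun ν => (measurePreserving_collide ν).map_eq)
    have hfun : (fun r : sphere (0 : EuclideanSpace ℝ d) 1 ×
        (EuclideanSpace ℝ d × EuclideanSpace ℝ d) => (f₀ r.1, collide r.1 r.2)) = Θ' :=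
      funext fun r => by rw [hΘ', hf₀_apply]
    rw [hfun] at hskew
    exact hskew
  -- as a measurable equivalence
  set Θ'e : sphere (0 : EuclideanSpace ℝ d) 1 × (EuclideanSpace ℝ d × EuclideanSpace ℝ d) ≃ᵐ
      sphere (0 : EuclideanSpace ℝ d) 1 × (EuclideanSpace ℝ d × EuclideanSpace ℝ d) :=
    { toFun := Θ'
      invFun := Θ'
      left_inv := hΘ'_invol
      right_inv := hΘ'_invol
      measurable_toFun := hΘ'_cont.measurable
      measurable_invFun := hΘ'_cont.measurable } with hΘ'e
  -- reorder the factors: `(ν, p) ↦ (p, ν)`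
  set e₀ : sphere (0 : EuclideanSpace ℝ d) 1 × (EuclideanSpace ℝ d × EuclideanSpace ℝ d) ≃ᵐ
      (EuclideanSpace ℝ d × EuclideanSpace ℝ d) × sphere (0 : EuclideanSpace ℝ d) 1 :=
    MeasurableEquiv.prodComm with he₀
  have he₀_mp : MeasurePreserving e₀ (sphereMeasure.prod volume)
      ((volume : Measure (EuclideanSpace ℝ d × EuclideanSpace ℝ d)).prod sphereMeasure) :=
    Measure.measurePreserving_swap
  refine ⟨e₀.symm.trans (Θ'e.trans e₀), fun q => rfl, ?_⟩
  exact he₀_mp.comp (hΘ'_mp.comp (he₀_mp.symm e₀))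

end Involution

/-! ## Invariance of the collision weight under the involution -/

section Invariance

variable {e : (EuclideanSpace ℝ d × EuclideanSpace ℝ d) × sphere (0 : EuclideanSpace ℝ d) 1 →
    (EuclideanSpace ℝ d × EuclideanSpace ℝ d) × sphere (0 : EuclideanSpace ℝ d) 1}

/-- The hard-sphere kernel is invariant under the collision involution. [folklore] -/
theorem collisionInvolution_kernel (he : ∀ q, e q = (collide q.2 q.1, -q.2))
    (q : (EuclideanSpace ℝ d × EuclideanSpace ℝ d) × sphere (0 : EuclideanSpace ℝ d) 1) :
    hardSphereKernel (e q).1 (e q).2 = hardSphereKernel q.1 q.2 := by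
  rw [he]
  exact Literature.Analysis.FluidPDE.isGradCutoffKernel_hardSphereKernel.collide_neg q.1 q.2

/-- Detailed balance `M_β(v') M_β(v₁') = M_β(v) M_β(v₁)` along the involution. [folklore] -/
theorem collisionInvolution_maxwellian (he : ∀ q, e q = (collide q.2 q.1, -q.2)) (β : ℝ)
    (q : (EuclideanSpace ℝ d × EuclideanSpace ℝ d) × sphere (0 : EuclideanSpace ℝ d) 1) :
    Literature.Analysis.FunctionSpaces.maxwellianBeta β (e q).1.1 * Literature.Analysis.FunctionSpaces.maxwellianBeta β (e q).1.2 =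
      Literature.Analysis.FunctionSpaces.maxwellianBeta β q.1.1 * Literature.Analysis.FunctionSpaces.maxwellianBeta β q.1.2 := by
  rw [he]
  exact maxwellianBeta_collide_mul β q.2 q.1.1 q.1.2

/-- The collision weight `((v - v₁)·ν)₊ M_β(v) M_β(v₁)` is invariant under the involution.
[folklore] -/
theorem collisionInvolution_weight (he : ∀ q, e q = (collide q.2 q.1, -q.2)) (β : ℝ)
    (q : (EuclideanSpace ℝ d × EuclideanSpace ℝ d) × sphere (0 : EuclideanSpace ℝ d) 1) :
    hardSphereKernel (e q).1 (e q).2 * Literature.Analysis.FunctionSpaces.maxwellianBeta β (e q).1.1 *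
        Literature.Analysis.FunctionSpaces.maxwellianBeta β (e q).1.2 =
      hardSphereKernel q.1 q.2 * Literature.Analysis.FunctionSpaces.maxwellianBeta β q.1.1 *
        Literature.Analysis.FunctionSpaces.maxwellianBeta β q.1.2 := by
  rw [mul_assoc, mul_assoc, collisionInvolution_kernel he, collisionInvolution_maxwellian he]

/-- The involution exchanges `v` and `v'`: the post-collisional velocity of the image is `v`.
[folklore] -/
theorem collisionInvolution_collide_fst (he : ∀ q, e q = (collide q.2 q.1, -q.2))
    (q : (EuclideanSpace ℝ d × EuclideanSpace ℝ d) × sphere (0 : EuclideanSpace ℝ d) 1) :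
    (collide (e q).2 (e q).1).1 = q.1.1 := by
  rw [he]
  simp only [collide_neg_sphere, collide_collide]

/-- The first velocity of the image is `v'`. [folklore] -/
theorem collisionInvolution_fst (he : ∀ q, e q = (collide q.2 q.1, -q.2))
    (q : (EuclideanSpace ℝ d × EuclideanSpace ℝ d) × sphere (0 : EuclideanSpace ℝ d) 1) :
    (e q).1.1 = (collide q.2 q.1).1 := by
  rw [he]

end Invariance

/-! ## Measurability and integrability of the collision weight -/

section Weight

variable {β : ℝ}

/-- Measurability of the collision weight `((v - v₁)·ν)₊ M_β(v) M_β(v₁)`. [folklore] -/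
theorem measurable_collisionWeight (β : ℝ) :
    Measurable fun q : (EuclideanSpace ℝ d × EuclideanSpace ℝ d) ×
      sphere (0 : EuclideanSpace ℝ d) 1 =>
      hardSphereKernel q.1 q.2 * Literature.Analysis.FunctionSpaces.maxwellianBeta β q.1.1 * Literature.Analysis.FunctionSpaces.maxwellianBeta β q.1.2 :=
  (continuous_hardSphereKernel.measurable.mul
    ((KineticTheory.measurable_maxwellianBeta β).comp (measurable_fst.comp measurable_fst))).mul
    ((KineticTheory.measurable_maxwellianBeta β).comp (measurable_snd.comp measurable_fst))

/-- The collision weight is nonnegative. [folklore] -/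
theorem collisionWeight_nonneg (hβ : 0 < β)
    (q : (EuclideanSpace ℝ d × EuclideanSpace ℝ d) × sphere (0 : EuclideanSpace ℝ d) 1) :
    0 ≤ hardSphereKernel q.1 q.2 * Literature.Analysis.FunctionSpaces.maxwellianBeta β q.1.1 *
      Literature.Analysis.FunctionSpaces.maxwellianBeta β q.1.2 :=
  mul_nonneg (mul_nonneg (hardSphereKernel_nonneg _ _) (Literature.Analysis.FunctionSpaces.maxwellianBeta_pos hβ _).le)
    (Literature.Analysis.FunctionSpaces.maxwellianBeta_pos hβ _).le

/-- For fixed `(v, v₁)`, `ν ↦ ((v - v₁)·ν)₊ c` is integrable on the sphere. [folklore] -/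
theorem integrable_hardSphereKernel_mul_const (p : EuclideanSpace ℝ d × EuclideanSpace ℝ d)
    (c : ℝ) : Integrable (fun ν => hardSphereKernel p ν * c) sphereMeasure := by
  refine ((integrable_const ((‖p.1‖ + ‖p.2‖) * |c|)).mono' ?_ (Eventually.of_forall fun ν => ?_))
  · exact ((continuous_hardSphereKernel.comp (Continuous.prodMk continuous_const
      continuous_id)).mul continuous_const).aestronglyMeasurable
  · rw [Real.norm_eq_abs, abs_mul, abs_of_nonneg (hardSphereKernel_nonneg _ _)]
    exact mul_le_mul_of_nonneg_right (hardSphereKernel_le p.1 p.2 ν) (abs_nonneg _)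

/-- **Tonelli for the collision weight**: if `∫ G a_β M_β < ∞` (`G ≥ 0` measurable) then
`((v - v₁)·ν)₊ M_β(v) M_β(v₁) G(v)` is integrable on `ℝ^d × ℝ^d × S^{d-1}`. [folklore] -/
theorem integrable_collisionWeight_mul (hβ : 0 < β) {G : EuclideanSpace ℝ d → ℝ} (hG : Measurable G)
    (hG0 : ∀ v, 0 ≤ G v)
    (hGi : Integrable fun v => G v * TaggedSphereDiffusion.collisionFrequency β v * Literature.Analysis.FunctionSpaces.maxwellianBeta β v) :
    Integrable (fun q : (EuclideanSpace ℝ d × EuclideanSpace ℝ d) ×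
        sphere (0 : EuclideanSpace ℝ d) 1 =>
      hardSphereKernel q.1 q.2 * Literature.Analysis.FunctionSpaces.maxwellianBeta β q.1.1 * Literature.Analysis.FunctionSpaces.maxwellianBeta β q.1.2 *
        G q.1.1)
      ((volume : Measure (EuclideanSpace ℝ d × EuclideanSpace ℝ d)).prod sphereMeasure) := by
  have hmeas : Measurable fun q : (EuclideanSpace ℝ d × EuclideanSpace ℝ d) ×
      sphere (0 : EuclideanSpace ℝ d) 1 =>
      hardSphereKernel q.1 q.2 * Literature.Analysis.FunctionSpaces.maxwellianBeta β q.1.1 * Literature.Analysis.FunctionSpaces.maxwellianBeta β q.1.2 *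
        G q.1.1 :=
    (measurable_collisionWeight β).mul (hG.comp (measurable_fst.comp measurable_fst))
  have hnn : ∀ q : (EuclideanSpace ℝ d × EuclideanSpace ℝ d) × sphere (0 : EuclideanSpace ℝ d) 1,
      0 ≤ hardSphereKernel q.1 q.2 * Literature.Analysis.FunctionSpaces.maxwellianBeta β q.1.1 *
        Literature.Analysis.FunctionSpaces.maxwellianBeta β q.1.2 * G q.1.1 := fun q =>
    mul_nonneg (collisionWeight_nonneg hβ q) (hG0 _)
  rw [integrable_prod_iff hmeas.aestronglyMeasurable]
  constructor
  · refine Eventually.of_forall fun p => ?_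
    refine (integrable_hardSphereKernel_mul_const p (Literature.Analysis.FunctionSpaces.maxwellianBeta β p.1 *
      Literature.Analysis.FunctionSpaces.maxwellianBeta β p.2 * G p.1)).congr (Eventually.of_forall fun ν => ?_)
    simp only
    ring
  · -- the `ν`-integral is `λ(v - v₁) M_β(v₁) (M_β(v) G(v))`
    have hinner : ∀ p : EuclideanSpace ℝ d × EuclideanSpace ℝ d,
        ∫ ν, ‖hardSphereKernel p ν * Literature.Analysis.FunctionSpaces.maxwellianBeta β p.1 * Literature.Analysis.FunctionSpaces.maxwellianBeta β p.2 *
          G p.1‖ ∂sphereMeasure =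
        KineticTheory.lorentzLossRate (p.1 - p.2) * Literature.Analysis.FunctionSpaces.maxwellianBeta β p.2 *
          (Literature.Analysis.FunctionSpaces.maxwellianBeta β p.1 * G p.1) := fun p => by
      rw [← integral_hardSphereKernel, ← integral_mul_const, ← integral_mul_const]
      refine integral_congr_ae (Eventually.of_forall fun ν => ?_)
      dsimp only
      rw [Real.norm_of_nonneg (hnn (p, ν))]
      ring
    have hmeas2 : Measurable fun p : EuclideanSpace ℝ d × EuclideanSpace ℝ d =>
        KineticTheory.lorentzLossRate (p.1 - p.2) * Literature.Analysis.FunctionSpaces.maxwellianBeta β p.2 *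
          (Literature.Analysis.FunctionSpaces.maxwellianBeta β p.1 * G p.1) :=
      ((KineticTheory.continuous_lorentzLossRate.measurable.comp (measurable_fst.sub measurable_snd)).mul
        ((KineticTheory.measurable_maxwellianBeta β).comp measurable_snd)).mul
        (((KineticTheory.measurable_maxwellianBeta β).comp measurable_fst).mul (hG.comp measurable_fst))
    have h2 : Integrable (fun p : EuclideanSpace ℝ d × EuclideanSpace ℝ d =>
        KineticTheory.lorentzLossRate (p.1 - p.2) * Literature.Analysis.FunctionSpaces.maxwellianBeta β p.2 *
          (Literature.Analysis.FunctionSpaces.maxwellianBeta β p.1 * G p.1))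
        ((volume : Measure (EuclideanSpace ℝ d)).prod volume) := by
      rw [integrable_prod_iff hmeas2.aestronglyMeasurable]
      constructor
      · refine Eventually.of_forall fun v => ?_
        dsimp only
        exact (integrable_lorentzLossRate_mul_maxwellianBeta hβ v).mul_const _
      · refine hGi.congr (Eventually.of_forall fun v => ?_)
        dsimp only
        rw [collisionFrequency_eq]
        calc G v * (∫ w, KineticTheory.lorentzLossRate (v - w) * Literature.Analysis.FunctionSpaces.maxwellianBeta β w) *
              Literature.Analysis.FunctionSpaces.maxwellianBeta β v
            = (∫ w, KineticTheory.lorentzLossRate (v - w) * Literature.Analysis.FunctionSpaces.maxwellianBeta β w) *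
                (Literature.Analysis.FunctionSpaces.maxwellianBeta β v * G v) := by ring
          _ = ∫ w, KineticTheory.lorentzLossRate (v - w) * Literature.Analysis.FunctionSpaces.maxwellianBeta β w *
                (Literature.Analysis.FunctionSpaces.maxwellianBeta β v * G v) := (integral_mul_const _ _).symm
          _ = _ := integral_congr_ae (Eventually.of_forall fun w => ?_)
        dsimp only
        rw [Real.norm_of_nonneg (mul_nonneg (mul_nonneg (KineticTheory.lorentzLossRate_nonneg _)
          (Literature.Analysis.FunctionSpaces.maxwellianBeta_pos hβ _).le) (mul_nonneg (Literature.Analysis.FunctionSpaces.maxwellianBeta_pos hβ _).le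
          (hG0 _)))]
    exact h2.congr (Eventually.of_forall fun p => (hinner p).symm)

/-- Tonelli for the collision weight with `g(v)²`. [folklore] -/
theorem integrable_collisionWeight_mul_sq (hβ : 0 < β) {g : EuclideanSpace ℝ d → ℝ}
    (hg : Measurable g)
    (hg2 : Integrable fun v => g v ^ 2 * TaggedSphereDiffusion.collisionFrequency β v * Literature.Analysis.FunctionSpaces.maxwellianBeta β v) :
    Integrable (fun q : (EuclideanSpace ℝ d × EuclideanSpace ℝ d) ×
        sphere (0 : EuclideanSpace ℝ d) 1 =>
      hardSphereKernel q.1 q.2 * Literature.Analysis.FunctionSpaces.maxwellianBeta β q.1.1 * Literature.Analysis.FunctionSpaces.maxwellianBeta β q.1.2 *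
        g q.1.1 ^ 2)
      ((volume : Measure (EuclideanSpace ℝ d × EuclideanSpace ℝ d)).prod sphereMeasure) :=
  integrable_collisionWeight_mul hβ (hg.pow_const 2) (fun _ => sq_nonneg _) hg2

/-- The same with `g(v')²` in place of `g(v)²` (by the collision involution). [folklore] -/
theorem integrable_collisionWeight_mul_sq_collide (hβ : 0 < β) {g : EuclideanSpace ℝ d → ℝ}
    (hg : Measurable g)
    (hg2 : Integrable fun v => g v ^ 2 * TaggedSphereDiffusion.collisionFrequency β v * Literature.Analysis.FunctionSpaces.maxwellianBeta β v) :
    Integrable (fun q : (EuclideanSpace ℝ d × EuclideanSpace ℝ d) ×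
        sphere (0 : EuclideanSpace ℝ d) 1 =>
      hardSphereKernel q.1 q.2 * Literature.Analysis.FunctionSpaces.maxwellianBeta β q.1.1 * Literature.Analysis.FunctionSpaces.maxwellianBeta β q.1.2 *
        g (collide q.2 q.1).1 ^ 2)
      ((volume : Measure (EuclideanSpace ℝ d × EuclideanSpace ℝ d)).prod sphereMeasure) := by
  obtain ⟨e, he, hmp⟩ := exists_collisionInvolution (d := d)
  have h1 := (hmp.integrable_comp_emb e.measurableEmbedding).2
    (integrable_collisionWeight_mul_sq hβ hg hg2)
  refine h1.congr (Eventually.of_forall fun q => ?_)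
  simp only [Function.comp_apply]
  rw [collisionInvolution_weight he, collisionInvolution_fst he]

end Weight
/-! ## The weak form of `L` and its symmetrisation -/

section WeakForm

variable {β : ℝ}

/-- `|(a - b) c| ≤ a²/2 + b²/2 + c²`. [folklore] -/
theorem abs_sub_mul_le_half_sq_add (a b c : ℝ) : |(a - b) * c| ≤ a ^ 2 / 2 + b ^ 2 / 2 + c ^ 2 := by
  rw [abs_mul]
  have h1 : |a - b| ≤ |a| + |b| := abs_sub a b
  have h2 : |a - b| * |c| ≤ (|a| + |b|) * |c| := mul_le_mul_of_nonneg_right h1 (abs_nonneg c)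
  have h3 : 2 * |a| * |c| ≤ |a| ^ 2 + |c| ^ 2 := two_mul_le_add_sq _ _
  have h4 : 2 * |b| * |c| ≤ |b| ^ 2 + |c| ^ 2 := two_mul_le_add_sq _ _
  rw [sq_abs, sq_abs] at h3 h4
  nlinarith

/-- `|(a - b)(c - e)| ≤ (a - b)²/2 + (c - e)²/2` and `(a - b)² ≤ 2a² + 2b²`: the elementary
inequalities behind the integrability of the symmetrised forms. [folklore] -/
theorem sub_sq_le_two_mul_sq_add (a b : ℝ) : (a - b) ^ 2 ≤ 2 * a ^ 2 + 2 * b ^ 2 := by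
  nlinarith [sq_nonneg (a + b)]

/-- **Integrability of the weak-form integrand** `((v - v₁)·ν)₊ M_β M_β,₁ (g(v) - g(v')) h(v)` on
`ℝ^d × ℝ^d × S^{d-1}` for `g, h ∈ L²(a_β M_β dv)`. [folklore] -/
theorem integrable_collisionForm (hβ : 0 < β) {g h : EuclideanSpace ℝ d → ℝ} (hg : Measurable g)
    (hh : Measurable h)
    (hg2 : Integrable fun v => g v ^ 2 * TaggedSphereDiffusion.collisionFrequency β v * Literature.Analysis.FunctionSpaces.maxwellianBeta β v)
    (hh2 : Integrable fun v => h v ^ 2 * TaggedSphereDiffusion.collisionFrequency β v * Literature.Analysis.FunctionSpaces.maxwellianBeta β v) :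
    Integrable (fun q : (EuclideanSpace ℝ d × EuclideanSpace ℝ d) ×
        sphere (0 : EuclideanSpace ℝ d) 1 =>
      hardSphereKernel q.1 q.2 * Literature.Analysis.FunctionSpaces.maxwellianBeta β q.1.1 * Literature.Analysis.FunctionSpaces.maxwellianBeta β q.1.2 *
        ((g q.1.1 - g (collide q.2 q.1).1) * h q.1.1))
      ((volume : Measure (EuclideanSpace ℝ d × EuclideanSpace ℝ d)).prod sphereMeasure) := by
  have hP1 := integrable_collisionWeight_mul_sq hβ hg hg2
  have hP2 := integrable_collisionWeight_mul_sq hβ hh hh2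
  have hP3 := integrable_collisionWeight_mul_sq_collide hβ hg hg2
  refine ((((hP1.div_const 2).add (hP3.div_const 2)).add hP2).mono' ?_
    (Eventually.of_forall fun q => ?_))
  · exact ((measurable_collisionWeight β).mul (((hg.comp (measurable_fst.comp
      measurable_fst)).sub (hg.comp continuous_collide_fst.measurable)).mul
      (hh.comp (measurable_fst.comp measurable_fst)))).aestronglyMeasurable
  · have hW := collisionWeight_nonneg hβ q
    rw [Real.norm_eq_abs, abs_mul, abs_of_nonneg hW]
    have := abs_sub_mul_le_half_sq_add (g q.1.1) (g (collide q.2 q.1).1) (h q.1.1)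
    simp only [Pi.add_apply]
    nlinarith

/-- **The weak form of the linear Boltzmann operator.** For `g, h ∈ L²(a_β M_β dv)`,
`v ↦ (L g)(v) h(v) M_β(v)` is integrable and
`∫ (L g) h M_β dv = ∫∫∫ ((v - v₁)·ν)₊ M_β(v) M_β(v₁) (g(v) - g(v')) h(v) dν dv₁ dv` (Fubini; the
junk-valued iterated Bochner integrals defining `L g` agree with the absolutely convergent triple
integral after integration against `h M_β`). [folklore] -/
theorem integral_linearBoltzmannOp_mul (hβ : 0 < β) {g h : EuclideanSpace ℝ d → ℝ}
    (hg : Measurable g) (hh : Measurable h)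
    (hg2 : Integrable fun v => g v ^ 2 * TaggedSphereDiffusion.collisionFrequency β v * Literature.Analysis.FunctionSpaces.maxwellianBeta β v)
    (hh2 : Integrable fun v => h v ^ 2 * TaggedSphereDiffusion.collisionFrequency β v * Literature.Analysis.FunctionSpaces.maxwellianBeta β v) :
    Integrable (fun v => linearBoltzmannOp β g v * h v * Literature.Analysis.FunctionSpaces.maxwellianBeta β v) ∧
      ∫ v, linearBoltzmannOp β g v * h v * Literature.Analysis.FunctionSpaces.maxwellianBeta β v =
        ∫ q : (EuclideanSpace ℝ d × EuclideanSpace ℝ d) × sphere (0 : EuclideanSpace ℝ d) 1,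
          hardSphereKernel q.1 q.2 * Literature.Analysis.FunctionSpaces.maxwellianBeta β q.1.1 *
            Literature.Analysis.FunctionSpaces.maxwellianBeta β q.1.2 * ((g q.1.1 - g (collide q.2 q.1).1) * h q.1.1)
          ∂((volume : Measure (EuclideanSpace ℝ d × EuclideanSpace ℝ d)).prod sphereMeasure) := by
  set F : (EuclideanSpace ℝ d × EuclideanSpace ℝ d) × sphere (0 : EuclideanSpace ℝ d) 1 → ℝ :=
    fun q => hardSphereKernel q.1 q.2 * Literature.Analysis.FunctionSpaces.maxwellianBeta β q.1.1 *
      Literature.Analysis.FunctionSpaces.maxwellianBeta β q.1.2 * ((g q.1.1 - g (collide q.2 q.1).1) * h q.1.1) with hF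
  have hFi : Integrable F ((volume : Measure (EuclideanSpace ℝ d × EuclideanSpace ℝ d)).prod
      sphereMeasure) := integrable_collisionForm hβ hg hh hg2 hh2
  -- Fubini, twice
  have h1 : ∫ q, F q ∂((volume : Measure (EuclideanSpace ℝ d × EuclideanSpace ℝ d)).prod
      sphereMeasure) = ∫ p, ∫ ν, F (p, ν) ∂sphereMeasure := integral_prod F hFi
  have hFi2 : Integrable (fun p : EuclideanSpace ℝ d × EuclideanSpace ℝ d =>
      ∫ ν, F (p, ν) ∂sphereMeasure) := hFi.integral_prod_left
  have h2 : ∫ p, ∫ ν, F (p, ν) ∂sphereMeasure =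
      ∫ v, ∫ w, ∫ ν, F ((v, w), ν) ∂sphereMeasure := integral_prod _ hFi2
  have hFi3 : Integrable (fun v : EuclideanSpace ℝ d => ∫ w, ∫ ν, F ((v, w), ν) ∂sphereMeasure) :=
    hFi2.integral_prod_left
  -- the iterated integral is `(L g)(v) h(v) M_β(v)` for every `v`
  have hid : ∀ v, ∫ w, ∫ ν, F ((v, w), ν) ∂sphereMeasure =
      linearBoltzmannOp β g v * h v * Literature.Analysis.FunctionSpaces.maxwellianBeta β v := fun v => by
    have hw : ∀ w, ∫ ν, F ((v, w), ν) ∂sphereMeasure = (Literature.Analysis.FunctionSpaces.maxwellianBeta β v * h v) *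
        ∫ ν, hardSphereKernel (v, w) ν * Literature.Analysis.FunctionSpaces.maxwellianBeta β w *
          (g v - g (collide ν (v, w)).1) ∂sphereMeasure := fun w => by
      rw [← integral_const_mul]
      refine integral_congr_ae (Eventually.of_forall fun ν => ?_)
      simp only [hF]
      ring
    simp_rw [hw]
    rw [integral_const_mul]
    have hL : linearBoltzmannOp β g v = ∫ w, ∫ ν, hardSphereKernel (v, w) ν *
        Literature.Analysis.FunctionSpaces.maxwellianBeta β w * (g v - g (collide ν (v, w)).1) ∂sphereMeasure := rfl
    rw [← hL]
    ring
  refine ⟨hFi3.congr (Eventually.of_forall hid), ?_⟩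
  rw [h1, h2]
  exact (integral_congr_ae (Eventually.of_forall hid)).symm

/-- **Symmetry of the weak form under the collision involution**:
`∫∫∫ W (g(v) - g(v')) h(v) = ∫∫∫ W (g(v') - g(v)) h(v')`, `W = ((v - v₁)·ν)₊ M_β(v) M_β(v₁)`
(change of variables `(v, v₁, ν) ↦ (v', v₁', -ν)`; no integrability needed). [folklore] -/
theorem integral_collisionForm_symm (β : ℝ) (g h : EuclideanSpace ℝ d → ℝ) :
    ∫ q : (EuclideanSpace ℝ d × EuclideanSpace ℝ d) × sphere (0 : EuclideanSpace ℝ d) 1,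
        hardSphereKernel q.1 q.2 * Literature.Analysis.FunctionSpaces.maxwellianBeta β q.1.1 *
          Literature.Analysis.FunctionSpaces.maxwellianBeta β q.1.2 * ((g q.1.1 - g (collide q.2 q.1).1) * h q.1.1)
        ∂((volume : Measure (EuclideanSpace ℝ d × EuclideanSpace ℝ d)).prod sphereMeasure) =
      ∫ q : (EuclideanSpace ℝ d × EuclideanSpace ℝ d) × sphere (0 : EuclideanSpace ℝ d) 1,
        hardSphereKernel q.1 q.2 * Literature.Analysis.FunctionSpaces.maxwellianBeta β q.1.1 *
          Literature.Analysis.FunctionSpaces.maxwellianBeta β q.1.2 *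
          ((g (collide q.2 q.1).1 - g q.1.1) * h (collide q.2 q.1).1)
        ∂((volume : Measure (EuclideanSpace ℝ d × EuclideanSpace ℝ d)).prod sphereMeasure) := by
  obtain ⟨e, he, hmp⟩ := exists_collisionInvolution (d := d)
  set G : (EuclideanSpace ℝ d × EuclideanSpace ℝ d) × sphere (0 : EuclideanSpace ℝ d) 1 → ℝ :=
    fun q => hardSphereKernel q.1 q.2 * Literature.Analysis.FunctionSpaces.maxwellianBeta β q.1.1 *
      Literature.Analysis.FunctionSpaces.maxwellianBeta β q.1.2 *
        ((g (collide q.2 q.1).1 - g q.1.1) * h (collide q.2 q.1).1) with hG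
  calc _ = ∫ q, G (e q) ∂((volume : Measure (EuclideanSpace ℝ d × EuclideanSpace ℝ d)).prod
        sphereMeasure) := by
          refine integral_congr_ae (Eventually.of_forall fun q => ?_)
          simp only [hG]
          rw [collisionInvolution_weight he, collisionInvolution_collide_fst he,
            collisionInvolution_fst he]
    _ = ∫ q, G q ∂((volume : Measure (EuclideanSpace ℝ d × EuclideanSpace ℝ d)).prod
        sphereMeasure) := hmp.integral_comp' G

/-- **The symmetrised weak form**: for `g, h ∈ L²(a_β M_β dv)`,
`2 ∫∫∫ W (g(v) - g(v')) h(v) = ∫∫∫ W (g(v) - g(v')) (h(v) - h(v'))`. [folklore] -/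
theorem two_mul_integral_collisionForm (hβ : 0 < β) {g h : EuclideanSpace ℝ d → ℝ}
    (hg : Measurable g) (hh : Measurable h)
    (hg2 : Integrable fun v => g v ^ 2 * TaggedSphereDiffusion.collisionFrequency β v * Literature.Analysis.FunctionSpaces.maxwellianBeta β v)
    (hh2 : Integrable fun v => h v ^ 2 * TaggedSphereDiffusion.collisionFrequency β v * Literature.Analysis.FunctionSpaces.maxwellianBeta β v) :
    2 * ∫ q : (EuclideanSpace ℝ d × EuclideanSpace ℝ d) × sphere (0 : EuclideanSpace ℝ d) 1,
        hardSphereKernel q.1 q.2 * Literature.Analysis.FunctionSpaces.maxwellianBeta β q.1.1 *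
          Literature.Analysis.FunctionSpaces.maxwellianBeta β q.1.2 * ((g q.1.1 - g (collide q.2 q.1).1) * h q.1.1)
        ∂((volume : Measure (EuclideanSpace ℝ d × EuclideanSpace ℝ d)).prod sphereMeasure) =
      ∫ q : (EuclideanSpace ℝ d × EuclideanSpace ℝ d) × sphere (0 : EuclideanSpace ℝ d) 1,
        hardSphereKernel q.1 q.2 * Literature.Analysis.FunctionSpaces.maxwellianBeta β q.1.1 *
          Literature.Analysis.FunctionSpaces.maxwellianBeta β q.1.2 *
          ((g q.1.1 - g (collide q.2 q.1).1) * (h q.1.1 - h (collide q.2 q.1).1))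
        ∂((volume : Measure (EuclideanSpace ℝ d × EuclideanSpace ℝ d)).prod sphereMeasure) := by
  have hI1 := integrable_collisionForm hβ hg hh hg2 hh2
  obtain ⟨e, he, hmp⟩ := exists_collisionInvolution (d := d)
  have hI2 : Integrable (fun q : (EuclideanSpace ℝ d × EuclideanSpace ℝ d) ×
      sphere (0 : EuclideanSpace ℝ d) 1 =>
      hardSphereKernel q.1 q.2 * Literature.Analysis.FunctionSpaces.maxwellianBeta β q.1.1 * Literature.Analysis.FunctionSpaces.maxwellianBeta β q.1.2 *
        ((g (collide q.2 q.1).1 - g q.1.1) * h (collide q.2 q.1).1))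
      ((volume : Measure (EuclideanSpace ℝ d × EuclideanSpace ℝ d)).prod sphereMeasure) := by
    refine ((hmp.integrable_comp_emb e.measurableEmbedding).2 hI1).congr
      (Eventually.of_forall fun q => ?_)
    simp only [Function.comp_apply]
    rw [collisionInvolution_weight he, collisionInvolution_collide_fst he,
      collisionInvolution_fst he]
  have hs := integral_collisionForm_symm β g h
  rw [two_mul]
  conv_lhs => arg 2; rw [hs]
  rw [← integral_add hI1 hI2]
  refine integral_congr_ae (Eventually.of_forall fun q => ?_)
  ring

/-- **Cauchy–Schwarz for a weighted quadratic form** on an arbitrary measure space: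
`(∫ W u w)² ≤ (∫ W u²)(∫ W w²)` for `W ≥ 0`, given the three integrability conditions (the
discriminant of `t ↦ ∫ W (u - t w)² ≥ 0`). [folklore] -/
theorem sq_integral_weight_mul_le {α : Type*} {m : MeasurableSpace α} {μ : Measure α}
    {W u w : α → ℝ} (hW : ∀ x, 0 ≤ W x) (hA : Integrable (fun x => W x * u x ^ 2) μ)
    (hC : Integrable (fun x => W x * w x ^ 2) μ)
    (hB : Integrable (fun x => W x * (u x * w x)) μ) :
    (∫ x, W x * (u x * w x) ∂μ) ^ 2 ≤ (∫ x, W x * u x ^ 2 ∂μ) * (∫ x, W x * w x ^ 2 ∂μ) := by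
  have key : ∀ t : ℝ, 0 ≤ (∫ x, W x * u x ^ 2 ∂μ) - 2 * t * (∫ x, W x * (u x * w x) ∂μ) +
      t ^ 2 * (∫ x, W x * w x ^ 2 ∂μ) := fun t => by
    have h0 : 0 ≤ ∫ x, W x * (u x - t * w x) ^ 2 ∂μ :=
      integral_nonneg fun x => mul_nonneg (hW x) (sq_nonneg _)
    have h1 : ∫ x, W x * (u x - t * w x) ^ 2 ∂μ =
        ∫ x, (W x * u x ^ 2 - 2 * t * (W x * (u x * w x)) + t ^ 2 * (W x * w x ^ 2)) ∂μ :=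
      integral_congr_ae (Eventually.of_forall fun x => by ring)
    have hAB : Integrable (fun x => W x * u x ^ 2 - 2 * t * (W x * (u x * w x))) μ :=
      hA.sub (hB.const_mul _)
    have hC' : Integrable (fun x => t ^ 2 * (W x * w x ^ 2)) μ := hC.const_mul _
    have h2 : ∫ x, (W x * u x ^ 2 - 2 * t * (W x * (u x * w x)) + t ^ 2 * (W x * w x ^ 2)) ∂μ =
        (∫ x, (W x * u x ^ 2 - 2 * t * (W x * (u x * w x))) ∂μ) +
          ∫ x, t ^ 2 * (W x * w x ^ 2) ∂μ := integral_add hAB hC'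
    have h3 : ∫ x, (W x * u x ^ 2 - 2 * t * (W x * (u x * w x))) ∂μ =
        (∫ x, W x * u x ^ 2 ∂μ) - ∫ x, 2 * t * (W x * (u x * w x)) ∂μ :=
      integral_sub hA (hB.const_mul _)
    rw [h1, h2, h3, integral_const_mul, integral_const_mul] at h0
    linarith
  have hdisc : discrim (∫ x, W x * w x ^ 2 ∂μ) (-2 * ∫ x, W x * (u x * w x) ∂μ)
      (∫ x, W x * u x ^ 2 ∂μ) ≤ 0 :=
    discrim_le_zero fun t => by
      have := key t
      linarith [show (∫ x, W x * w x ^ 2 ∂μ) * (t * t) + (-2 * ∫ x, W x * (u x * w x) ∂μ) * t +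
        (∫ x, W x * u x ^ 2 ∂μ) = (∫ x, W x * u x ^ 2 ∂μ) - 2 * t * (∫ x, W x * (u x * w x) ∂μ) +
          t ^ 2 * (∫ x, W x * w x ^ 2 ∂μ) by ring]
  rw [discrim] at hdisc
  nlinarith [hdisc]

/-- **Cauchy–Schwarz for the collision Dirichlet form**: for `g, h ∈ L²(a_β M_β dv)`,
`(∫∫∫ W (g - g')(h - h'))² ≤ (∫∫∫ W (g - g')²) (∫∫∫ W (h - h')²)`. [folklore] -/
theorem sq_integral_collisionForm_le (hβ : 0 < β) {g h : EuclideanSpace ℝ d → ℝ}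
    (hg : Measurable g) (hh : Measurable h)
    (hg2 : Integrable fun v => g v ^ 2 * TaggedSphereDiffusion.collisionFrequency β v * Literature.Analysis.FunctionSpaces.maxwellianBeta β v)
    (hh2 : Integrable fun v => h v ^ 2 * TaggedSphereDiffusion.collisionFrequency β v * Literature.Analysis.FunctionSpaces.maxwellianBeta β v) :
    (∫ q : (EuclideanSpace ℝ d × EuclideanSpace ℝ d) × sphere (0 : EuclideanSpace ℝ d) 1,
        hardSphereKernel q.1 q.2 * Literature.Analysis.FunctionSpaces.maxwellianBeta β q.1.1 *
          Literature.Analysis.FunctionSpaces.maxwellianBeta β q.1.2 *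
          ((g q.1.1 - g (collide q.2 q.1).1) * (h q.1.1 - h (collide q.2 q.1).1))
        ∂((volume : Measure (EuclideanSpace ℝ d × EuclideanSpace ℝ d)).prod sphereMeasure)) ^ 2 ≤
      (∫ q : (EuclideanSpace ℝ d × EuclideanSpace ℝ d) × sphere (0 : EuclideanSpace ℝ d) 1,
        hardSphereKernel q.1 q.2 * Literature.Analysis.FunctionSpaces.maxwellianBeta β q.1.1 *
          Literature.Analysis.FunctionSpaces.maxwellianBeta β q.1.2 * (g q.1.1 - g (collide q.2 q.1).1) ^ 2
        ∂((volume : Measure (EuclideanSpace ℝ d × EuclideanSpace ℝ d)).prod sphereMeasure)) *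
      (∫ q : (EuclideanSpace ℝ d × EuclideanSpace ℝ d) × sphere (0 : EuclideanSpace ℝ d) 1,
        hardSphereKernel q.1 q.2 * Literature.Analysis.FunctionSpaces.maxwellianBeta β q.1.1 *
          Literature.Analysis.FunctionSpaces.maxwellianBeta β q.1.2 * (h q.1.1 - h (collide q.2 q.1).1) ^ 2
        ∂((volume : Measure (EuclideanSpace ℝ d × EuclideanSpace ℝ d)).prod sphereMeasure)) := by
  -- the three integrands are integrable
  have hmeasW := measurable_collisionWeight (d := d) β
  have hDg : Measurable fun q : (EuclideanSpace ℝ d × EuclideanSpace ℝ d) ×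
      sphere (0 : EuclideanSpace ℝ d) 1 => g q.1.1 - g (collide q.2 q.1).1 :=
    (hg.comp (measurable_fst.comp measurable_fst)).sub (hg.comp continuous_collide_fst.measurable)
  have hDh : Measurable fun q : (EuclideanSpace ℝ d × EuclideanSpace ℝ d) ×
      sphere (0 : EuclideanSpace ℝ d) 1 => h q.1.1 - h (collide q.2 q.1).1 :=
    (hh.comp (measurable_fst.comp measurable_fst)).sub (hh.comp continuous_collide_fst.measurable)
  have hA : Integrable (fun q : (EuclideanSpace ℝ d × EuclideanSpace ℝ d) ×
      sphere (0 : EuclideanSpace ℝ d) 1 =>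
      hardSphereKernel q.1 q.2 * Literature.Analysis.FunctionSpaces.maxwellianBeta β q.1.1 * Literature.Analysis.FunctionSpaces.maxwellianBeta β q.1.2 *
        (g q.1.1 - g (collide q.2 q.1).1) ^ 2)
      ((volume : Measure (EuclideanSpace ℝ d × EuclideanSpace ℝ d)).prod sphereMeasure) := by
    refine ((((integrable_collisionWeight_mul_sq hβ hg hg2).add
      (integrable_collisionWeight_mul_sq_collide hβ hg hg2)).const_mul 2).mono'
      (hmeasW.mul (hDg.pow_const 2)).aestronglyMeasurable (Eventually.of_forall fun q => ?_))
    have hW := collisionWeight_nonneg hβ q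
    rw [Real.norm_of_nonneg (mul_nonneg hW (sq_nonneg _))]
    have := sub_sq_le_two_mul_sq_add (g q.1.1) (g (collide q.2 q.1).1)
    simp only [Pi.add_apply]
    nlinarith
  have hC : Integrable (fun q : (EuclideanSpace ℝ d × EuclideanSpace ℝ d) ×
      sphere (0 : EuclideanSpace ℝ d) 1 =>
      hardSphereKernel q.1 q.2 * Literature.Analysis.FunctionSpaces.maxwellianBeta β q.1.1 * Literature.Analysis.FunctionSpaces.maxwellianBeta β q.1.2 *
        (h q.1.1 - h (collide q.2 q.1).1) ^ 2)
      ((volume : Measure (EuclideanSpace ℝ d × EuclideanSpace ℝ d)).prod sphereMeasure) := by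
    refine ((((integrable_collisionWeight_mul_sq hβ hh hh2).add
      (integrable_collisionWeight_mul_sq_collide hβ hh hh2)).const_mul 2).mono'
      (hmeasW.mul (hDh.pow_const 2)).aestronglyMeasurable (Eventually.of_forall fun q => ?_))
    have hW := collisionWeight_nonneg hβ q
    rw [Real.norm_of_nonneg (mul_nonneg hW (sq_nonneg _))]
    have := sub_sq_le_two_mul_sq_add (h q.1.1) (h (collide q.2 q.1).1)
    simp only [Pi.add_apply]
    nlinarith
  have hB : Integrable (fun q : (EuclideanSpace ℝ d × EuclideanSpace ℝ d) ×
      sphere (0 : EuclideanSpace ℝ d) 1 =>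
      hardSphereKernel q.1 q.2 * Literature.Analysis.FunctionSpaces.maxwellianBeta β q.1.1 * Literature.Analysis.FunctionSpaces.maxwellianBeta β q.1.2 *
        ((g q.1.1 - g (collide q.2 q.1).1) * (h q.1.1 - h (collide q.2 q.1).1)))
      ((volume : Measure (EuclideanSpace ℝ d × EuclideanSpace ℝ d)).prod sphereMeasure) := by
    refine (((hA.add hC).div_const 2).mono' (hmeasW.mul (hDg.mul hDh)).aestronglyMeasurable
      (Eventually.of_forall fun q => ?_))
    have hW := collisionWeight_nonneg hβ q
    rw [Real.norm_eq_abs, abs_mul, abs_of_nonneg hW, abs_mul]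
    have := two_mul_le_add_sq (|g q.1.1 - g (collide q.2 q.1).1|)
      (|h q.1.1 - h (collide q.2 q.1).1|)
    rw [sq_abs, sq_abs] at this
    simp only [Pi.add_apply]
    nlinarith [abs_nonneg (g q.1.1 - g (collide q.2 q.1).1),
      abs_nonneg (h q.1.1 - h (collide q.2 q.1).1)]
  exact sq_integral_weight_mul_le (collisionWeight_nonneg hβ) hA hC hB

end WeakForm
/-! ## Coordinates, Gaussian moments, and the positivity of `κ_β` -/

section Positivity

variable {β : ℝ}

/-- A coordinate is dominated by the norm: `(v i)² ≤ |v|²`. [folklore] -/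
theorem sq_apply_le_norm_sq (v : EuclideanSpace ℝ d) (i : d) : v i ^ 2 ≤ ‖v‖ ^ 2 := by
  rw [EuclideanSpace.norm_sq_eq]
  simp only [Real.norm_eq_abs, sq_abs]
  exact Finset.single_le_sum (f := fun j => v j ^ 2) (fun j _ => sq_nonneg _) (Finset.mem_univ i)

/-- `v ↦ (v i)² M_β(v)` is integrable (second Gaussian moment). [folklore] -/
theorem integrable_sq_apply_mul_maxwellianBeta (hβ : 0 < β) (i : d) :
    Integrable fun v : EuclideanSpace ℝ d => v i ^ 2 * Literature.Analysis.FunctionSpaces.maxwellianBeta β v := by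
  have h2 := KineticTheory.integrable_pow_norm_mul_maxwellianBeta (d := d) hβ 2
  refine h2.mono' (((EuclideanSpace.proj (𝕜 := ℝ) i).continuous.pow 2).mul
    (KineticTheory.continuous_maxwellianBeta β)).aestronglyMeasurable (Eventually.of_forall fun v => ?_)
  rw [Real.norm_of_nonneg (mul_nonneg (sq_nonneg _) (Literature.Analysis.FunctionSpaces.maxwellianBeta_pos hβ v).le)]
  exact mul_le_mul_of_nonneg_right (sq_apply_le_norm_sq v i) (Literature.Analysis.FunctionSpaces.maxwellianBeta_pos hβ v).le

/-- The coordinate functions lie in `L²(a_β M_β dv)`: `∫ (v i)² a_β M_β < ∞` (the collision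
frequency grows linearly, Gaussian moments are finite). [folklore] -/
theorem integrable_sq_apply_mul_collisionFrequency_mul (hβ : 0 < β) (i : d) :
    Integrable fun v : EuclideanSpace ℝ d =>
      v i ^ 2 * TaggedSphereDiffusion.collisionFrequency β v * Literature.Analysis.FunctionSpaces.maxwellianBeta β v := by
  have h2 := KineticTheory.integrable_pow_norm_mul_maxwellianBeta (d := d) hβ 2
  have h3 := KineticTheory.integrable_pow_norm_mul_maxwellianBeta (d := d) hβ 3
  set S := KineticTheory.sphereMass (EuclideanSpace ℝ d) with hS
  set m₁ := KineticTheory.maxwellianMoment d β 1 with hm₁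
  refine (((h3.add (h2.const_mul m₁)).const_mul S).mono' ?_ (Eventually.of_forall fun v => ?_))
  · exact ((((EuclideanSpace.proj (𝕜 := ℝ) i).continuous.pow 2).mul
      (continuous_collisionFrequency hβ)).mul
      (KineticTheory.continuous_maxwellianBeta β)).aestronglyMeasurable
  · have hM := (Literature.Analysis.FunctionSpaces.maxwellianBeta_pos hβ v).le
    have ha := TaggedLinearBoltzmannSeries.collisionFrequency_nonneg hβ v
    have ha' := collisionFrequency_le hβ v
    have hvi := sq_apply_le_norm_sq v i
    rw [Real.norm_of_nonneg (mul_nonneg (mul_nonneg (sq_nonneg _) ha) hM)]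
    simp only [Pi.add_apply]
    calc v i ^ 2 * TaggedSphereDiffusion.collisionFrequency β v * Literature.Analysis.FunctionSpaces.maxwellianBeta β v
        ≤ ‖v‖ ^ 2 * (S * (‖v‖ + m₁)) * Literature.Analysis.FunctionSpaces.maxwellianBeta β v := by
          gcongr
      _ = S * (‖v‖ ^ 3 * Literature.Analysis.FunctionSpaces.maxwellianBeta β v +
            m₁ * (‖v‖ ^ 2 * Literature.Analysis.FunctionSpaces.maxwellianBeta β v)) := by
          ring

/-- `∫ (v i)² M_β(v) dv > 0`. [folklore] -/
theorem integral_sq_apply_mul_maxwellianBeta_pos (hβ : 0 < β) (i : d) :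
    0 < ∫ v : EuclideanSpace ℝ d, v i ^ 2 * Literature.Analysis.FunctionSpaces.maxwellianBeta β v := by
  classical
  rw [integral_pos_iff_support_of_nonneg (fun v => mul_nonneg (sq_nonneg _)
    (Literature.Analysis.FunctionSpaces.maxwellianBeta_pos hβ v).le) (integrable_sq_apply_mul_maxwellianBeta hβ i)]
  have hsupp : Function.support
      (fun v : EuclideanSpace ℝ d => v i ^ 2 * Literature.Analysis.FunctionSpaces.maxwellianBeta β v) =
      {v | v i ≠ 0} := by
    ext v
    simp only [Function.mem_support, ne_eq, mul_eq_zero, (Literature.Analysis.FunctionSpaces.maxwellianBeta_pos hβ v).ne',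
      or_false, pow_eq_zero_iff, OfNat.ofNat_ne_zero, not_false_eq_true, mem_setOf_eq]
  rw [hsupp]
  have hopen : IsOpen {v : EuclideanSpace ℝ d | v i ≠ 0} :=
    isOpen_ne_fun (EuclideanSpace.proj (𝕜 := ℝ) i).continuous continuous_const
  refine hopen.measure_pos volume ⟨EuclideanSpace.single i 1, ?_⟩
  simp

/-- The components of a diffusion corrector lie in `L²(a_β M_β dv)`. [folklore] -/
theorem IsDiffusionCorrector.integrable_sq_apply (hβ : 0 < β)
    {b : EuclideanSpace ℝ d → EuclideanSpace ℝ d}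
    (hb : IsDiffusionCorrector β b) (i : d) :
    Integrable fun v : EuclideanSpace ℝ d =>
      b v i ^ 2 * TaggedSphereDiffusion.collisionFrequency β v * Literature.Analysis.FunctionSpaces.maxwellianBeta β v := by
  obtain ⟨hbm, hbi, -, -⟩ := hb
  refine hbi.mono' ?_ (Eventually.of_forall fun v => ?_)
  · exact ((((EuclideanSpace.proj (𝕜 := ℝ) i).continuous.measurable.comp hbm).pow_const 2).mul
      (continuous_collisionFrequency hβ).measurable).mul
      (KineticTheory.measurable_maxwellianBeta β) |>.aestronglyMeasurable
  · have hM := (Literature.Analysis.FunctionSpaces.maxwellianBeta_pos hβ v).le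
    have ha := TaggedLinearBoltzmannSeries.collisionFrequency_nonneg hβ v
    rw [Real.norm_of_nonneg (mul_nonneg (mul_nonneg (sq_nonneg _) ha) hM)]
    exact mul_le_mul_of_nonneg_right (mul_le_mul_of_nonneg_right (sq_apply_le_norm_sq (b v) i) ha)
      hM

/-- The inner product on `ℝ^d` in coordinates. [folklore] -/
theorem inner_eq_sum_apply (v w : EuclideanSpace ℝ d) : ⟪v, w⟫_ℝ = ∑ i, v i * w i := by
  simp [PiLp.inner_apply, mul_comm]

/-- **Each component of a corrector has positive Dirichlet energy**: if `L b_i = v_i` (a.e.) with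
`b_i, v_i ∈ L²(a_β M_β)`, then `v ↦ v_i b_i(v) M_β(v)` is integrable and `∫ v_i b_i M_β dv > 0`.
Indeed `∫ v_i b_i M_β = ∫ (L b_i) b_i M_β = ¼ ∫∫∫ W (b_i - b_i')² ≥ 0`, and if it vanished,
Cauchy–Schwarz in the Dirichlet form would force `∫ v_i² M_β = ∫ (L b_i) v_i M_β = 0`. [folklore] -/
theorem integral_apply_mul_corrector_pos (hβ : 0 < β) {g : EuclideanSpace ℝ d → ℝ}
    (hg : Measurable g)
    (hg2 : Integrable fun v => g v ^ 2 * TaggedSphereDiffusion.collisionFrequency β v * Literature.Analysis.FunctionSpaces.maxwellianBeta β v)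
    (i : d) (hL : ∀ᵐ v : EuclideanSpace ℝ d, linearBoltzmannOp β g v = v i) :
    Integrable (fun v : EuclideanSpace ℝ d => v i * g v * Literature.Analysis.FunctionSpaces.maxwellianBeta β v) ∧
      0 < ∫ v : EuclideanSpace ℝ d, v i * g v * Literature.Analysis.FunctionSpaces.maxwellianBeta β v := by
  have hh : Measurable fun v : EuclideanSpace ℝ d => v i :=
    (EuclideanSpace.proj (𝕜 := ℝ) i).continuous.measurable
  have hh2 := integrable_sq_apply_mul_collisionFrequency_mul (d := d) hβ i
  -- the weak forms `∫ (L g) g M` and `∫ (L g) v_i M`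
  obtain ⟨hint_gg, hgg⟩ := integral_linearBoltzmannOp_mul hβ hg hg hg2 hg2
  obtain ⟨-, hgh⟩ := integral_linearBoltzmannOp_mul hβ hg hh hg2 hh2
  have hsymm_gg := two_mul_integral_collisionForm hβ hg hg hg2 hg2
  have hsymm_gh := two_mul_integral_collisionForm hβ hg hh hg2 hh2
  have hCS := sq_integral_collisionForm_le hβ hg hh hg2 hh2
  -- replace `L g` by `v_i`
  have e_gg : ∫ v, linearBoltzmannOp β g v * g v * Literature.Analysis.FunctionSpaces.maxwellianBeta β v =
      ∫ v : EuclideanSpace ℝ d, v i * g v * Literature.Analysis.FunctionSpaces.maxwellianBeta β v :=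
    integral_congr_ae (by filter_upwards [hL] with v hv; rw [hv])
  have e_gh : ∫ v, linearBoltzmannOp β g v * v i * Literature.Analysis.FunctionSpaces.maxwellianBeta β v =
      ∫ v : EuclideanSpace ℝ d, v i ^ 2 * Literature.Analysis.FunctionSpaces.maxwellianBeta β v :=
    integral_congr_ae (by filter_upwards [hL] with v hv; rw [hv]; ring)
  have hint : Integrable (fun v : EuclideanSpace ℝ d => v i * g v * Literature.Analysis.FunctionSpaces.maxwellianBeta β v) :=
    hint_gg.congr (by filter_upwards [hL] with v hv; rw [hv])
  refine ⟨hint, ?_⟩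
  have hpos := integral_sq_apply_mul_maxwellianBeta_pos (d := d) hβ i
  -- abbreviate the three Dirichlet integrals
  set A := ∫ q : (EuclideanSpace ℝ d × EuclideanSpace ℝ d) × sphere (0 : EuclideanSpace ℝ d) 1,
        hardSphereKernel q.1 q.2 * Literature.Analysis.FunctionSpaces.maxwellianBeta β q.1.1 *
          Literature.Analysis.FunctionSpaces.maxwellianBeta β q.1.2 *
          ((g q.1.1 - g (collide q.2 q.1).1) * (g q.1.1 - g (collide q.2 q.1).1))
        ∂((volume : Measure (EuclideanSpace ℝ d × EuclideanSpace ℝ d)).prod sphereMeasure) with hA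
  set B := ∫ q : (EuclideanSpace ℝ d × EuclideanSpace ℝ d) × sphere (0 : EuclideanSpace ℝ d) 1,
        hardSphereKernel q.1 q.2 * Literature.Analysis.FunctionSpaces.maxwellianBeta β q.1.1 *
          Literature.Analysis.FunctionSpaces.maxwellianBeta β q.1.2 *
          ((g q.1.1 - g (collide q.2 q.1).1) * (q.1.1 i - (collide q.2 q.1).1 i))
        ∂((volume : Measure (EuclideanSpace ℝ d × EuclideanSpace ℝ d)).prod sphereMeasure) with hB
  set A' := ∫ q : (EuclideanSpace ℝ d × EuclideanSpace ℝ d) × sphere (0 : EuclideanSpace ℝ d) 1,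
        hardSphereKernel q.1 q.2 * Literature.Analysis.FunctionSpaces.maxwellianBeta β q.1.1 *
          Literature.Analysis.FunctionSpaces.maxwellianBeta β q.1.2 * (g q.1.1 - g (collide q.2 q.1).1) ^ 2
        ∂((volume : Measure (EuclideanSpace ℝ d × EuclideanSpace ℝ d)).prod sphereMeasure) with hA'
  set C := ∫ q : (EuclideanSpace ℝ d × EuclideanSpace ℝ d) × sphere (0 : EuclideanSpace ℝ d) 1,
        hardSphereKernel q.1 q.2 * Literature.Analysis.FunctionSpaces.maxwellianBeta β q.1.1 *
          Literature.Analysis.FunctionSpaces.maxwellianBeta β q.1.2 * (q.1.1 i - (collide q.2 q.1).1 i) ^ 2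
        ∂((volume : Measure (EuclideanSpace ℝ d × EuclideanSpace ℝ d)).prod sphereMeasure) with hC
  have hAA' : A = A' := by
    simp only [hA, hA', sq]
  -- `2 ∫ v_i g M = A'`, `2 ∫ v_i² M = B`, `B² ≤ A' C`
  have h1 : 2 * ∫ v : EuclideanSpace ℝ d, v i * g v * Literature.Analysis.FunctionSpaces.maxwellianBeta β v = A' := by
    rw [← hAA', ← e_gg, hgg]; exact hsymm_gg
  have h2 : 2 * ∫ v : EuclideanSpace ℝ d, v i ^ 2 * Literature.Analysis.FunctionSpaces.maxwellianBeta β v = B := by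
    rw [← e_gh, hgh]; exact hsymm_gh
  by_contra hle
  rw [not_lt] at hle
  have hA'0 : A' ≤ 0 := by linarith
  have hA'nn : 0 ≤ A' :=
    integral_nonneg fun q => mul_nonneg (collisionWeight_nonneg hβ q) (sq_nonneg _)
  have hB0 : B = 0 := by
    have : B ^ 2 ≤ A' * C := hCS
    have hA'z : A' = 0 := le_antisymm hA'0 hA'nn
    rw [hA'z, zero_mul] at this
    nlinarith [sq_nonneg B]
  linarith

/-- **BGSR (6.8): positivity of the diffusion coefficient** `κ_β = d⁻¹ ∫ v · b(v) M_β(v) dv` for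
every diffusion corrector `b` (`L b = v`, `b ∈ L²(a_β M_β)`), `d ≥ 2`, `β > 0`: discharge of the
named fact `bgsr_diffusionCoeff_pos`. Proof: `∫ v · b M_β = ∑ᵢ ∫ vᵢ bᵢ M_β` and each term is
`⟨L bᵢ, bᵢ⟩_{L²(M_β)} = ¼ ∫∫∫ ((v - v₁)·ν)₊ M_β M_β,₁ (bᵢ(v) - bᵢ(v'))² ≥ 0` (symmetry of the
hard-sphere kernel under `(v, v₁, ν) ↦ (v', v₁', -ν)` and detailed balance), strictly, since its
vanishing would give `∫ vᵢ² M_β = ⟨L bᵢ, vᵢ⟩ = 0` by the Cauchy–Schwarz inequality for this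
nonnegative symmetric form.
[cite: BodineauGallagherSaintRaymondInvent2016, (6.8) and §6.2 Step 2] -/
theorem bgsr_diffusionCoeff_pos_holds : bgsr_diffusionCoeff_pos (d := d) := by
  intro hd β hβ b hb
  have hcard : 0 < Fintype.card d := by omega
  haveI : Nonempty d := Fintype.card_pos_iff.1 hcard
  obtain ⟨hbm, -, -, hL⟩ := id hb
  have hcomp : ∀ i : d,
      Integrable (fun v : EuclideanSpace ℝ d => v i * b v i * Literature.Analysis.FunctionSpaces.maxwellianBeta β v) ∧
        0 < ∫ v : EuclideanSpace ℝ d, v i * b v i * Literature.Analysis.FunctionSpaces.maxwellianBeta β v := fun i =>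
    integral_apply_mul_corrector_pos hβ
      ((EuclideanSpace.proj (𝕜 := ℝ) i).continuous.measurable.comp hbm)
      (hb.integrable_sq_apply hβ i) i (by filter_upwards [hL] with v hv; exact hv i)
  unfold bgsrDiffusionCoeff
  have hinner : ∀ v : EuclideanSpace ℝ d, ⟪v, b v⟫_ℝ * Literature.Analysis.FunctionSpaces.maxwellianBeta β v =
      ∑ i, v i * b v i * Literature.Analysis.FunctionSpaces.maxwellianBeta β v := fun v => by
    rw [inner_eq_sum_apply, Finset.sum_mul]
  simp_rw [hinner]
  rw [integral_finsetSum _ fun i _ => (hcomp i).1]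
  exact mul_pos (inv_pos.2 (by exact_mod_cast hcard))
    (Finset.sum_pos (fun i _ => (hcomp i).2) Finset.univ_nonempty)

end Positivity

/-! # Part II. Assembling Theorem 2.3 (one-time marginals) -/

open Literature.Analysis.FunctionSpaces Literature.Analysis.FluidPDE

/-! ## From an `L^∞` bound to an almost-everywhere bound -/

section LInfty

variable {Ω : Type*} [MeasurableSpace Ω] {μ : Measure Ω}

/-- `‖f‖_{L^∞(μ)} ≤ r` (with `0 ≤ r`) gives `|f| ≤ r` almost everywhere. [folklore] -/
theorem ae_abs_le_of_eLpNorm_top_le {f : Ω → ℝ} {r : ℝ} (hr : 0 ≤ r)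
    (h : eLpNorm f ∞ μ ≤ ENNReal.ofReal r) : ∀ᵐ x ∂μ, |f x| ≤ r := by
  rw [eLpNorm_exponent_top] at h
  filter_upwards [enorm_ae_le_eLpNormEssSup f μ] with x hx
  have := hx.trans h
  rwa [Real.enorm_eq_ofReal_abs, ENNReal.ofReal_le_ofReal_iff hr] at this

end LInfty

/-! ## The heat flow on the torus as a wrapped-Gaussian average -/

section Heat

omit [Fintype d] in
/-- A continuous real function on the (compact) torus is bounded in absolute value. [folklore] -/
theorem exists_abs_le_of_continuous {f : UnitAddTorus d → ℝ} (hf : Continuous f) :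
    ∃ C, ∀ x, |f x| ≤ C := by
  obtain ⟨C, hC⟩ := (isCompact_range hf).isBounded.subset_closedBall (0 : ℝ)
  exact ⟨C, fun x => by simpa [Real.dist_eq] using hC ⟨x, rfl⟩⟩

/-- Symmetry of the wrapped heat kernel:
`∫ φ · (G_{2κτ} * ρ⁰) = ∫ ρ⁰(x) 𝔼[φ(x + proj(√(2κτ) Z))] dx` (translation invariance of
Lebesgue measure on `T^d` and Fubini). [folklore] -/
theorem integral_mul_torusHeatSolution (κ : ℝ) {ρ₀ φ : UnitAddTorus d → ℝ} (hρ₀ : Continuous ρ₀)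
    (hφ : Continuous φ) (τ : ℝ) :
    ∫ x, φ x * torusHeatSolution κ ρ₀ τ x =
      ∫ x, ρ₀ x *
        ∫ z, φ (x + Torus.proj (Real.sqrt (2 * κ * τ) • z)) ∂stdGaussian (EuclideanSpace ℝ d) := by
  set c : ℝ := Real.sqrt (2 * κ * τ)
  obtain ⟨R, hR⟩ := exists_abs_le_of_continuous hρ₀
  obtain ⟨B, hB⟩ := exists_abs_le_of_continuous hφ
  have hw : Continuous fun z : EuclideanSpace ℝ d => Torus.proj (c • z) :=
    Torus.continuous_proj.comp (continuous_const_smul c)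
  have hF : Continuous fun p : UnitAddTorus d × EuclideanSpace ℝ d =>
      φ p.1 * ρ₀ (p.1 - Torus.proj (c • p.2)) :=
    (hφ.comp continuous_fst).mul (hρ₀.comp (continuous_fst.sub (hw.comp continuous_snd)))
  have hG : Continuous fun p : UnitAddTorus d × EuclideanSpace ℝ d =>
      ρ₀ p.1 * φ (p.1 + Torus.proj (c • p.2)) :=
    (hρ₀.comp continuous_fst).mul (hφ.comp (continuous_fst.add (hw.comp continuous_snd)))
  have hFi : Integrable
      (fun p : UnitAddTorus d × EuclideanSpace ℝ d => φ p.1 * ρ₀ (p.1 - Torus.proj (c • p.2)))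
      ((volume : Measure (UnitAddTorus d)).prod (stdGaussian (EuclideanSpace ℝ d))) := by
    refine Integrable.mono' (integrable_const (B * R)) hF.aestronglyMeasurable
      (Eventually.of_forall fun p => ?_)
    rw [Real.norm_eq_abs, abs_mul]
    exact mul_le_mul (hB _) (hR _) (abs_nonneg _) ((abs_nonneg _).trans (hB p.1))
  have hGi : Integrable
      (fun p : UnitAddTorus d × EuclideanSpace ℝ d => ρ₀ p.1 * φ (p.1 + Torus.proj (c • p.2)))
      ((volume : Measure (UnitAddTorus d)).prod (stdGaussian (EuclideanSpace ℝ d))) := by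
    refine Integrable.mono' (integrable_const (R * B)) hG.aestronglyMeasurable
      (Eventually.of_forall fun p => ?_)
    rw [Real.norm_eq_abs, abs_mul]
    exact mul_le_mul (hR _) (hB _) (abs_nonneg _) ((abs_nonneg _).trans (hR p.1))
  calc ∫ x, φ x * torusHeatSolution κ ρ₀ τ x
        = ∫ x, ∫ z, φ x * ρ₀ (x - Torus.proj (c • z)) ∂stdGaussian (EuclideanSpace ℝ d) := by
          refine integral_congr_ae (Eventually.of_forall fun x => ?_)
          exact (integral_const_mul _ _).symm
    _ = ∫ z, ∫ x, φ x * ρ₀ (x - Torus.proj (c • z)) ∂volume ∂stdGaussian (EuclideanSpace ℝ d) :=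
          integral_integral_swap hFi
    _ = ∫ z, ∫ x, φ (x + Torus.proj (c • z)) * ρ₀ x ∂volume ∂stdGaussian (EuclideanSpace ℝ d) := by
          refine integral_congr_ae (Eventually.of_forall fun z => ?_)
          have := integral_add_right_eq_self (μ := (volume : Measure (UnitAddTorus d)))
            (fun x => φ x * ρ₀ (x - Torus.proj (c • z))) (Torus.proj (c • z))
          simp only [add_sub_cancel_right] at this
          exact this.symm
    _ = ∫ z, ∫ x, ρ₀ x * φ (x + Torus.proj (c • z)) ∂volume ∂stdGaussian (EuclideanSpace ℝ d) := by
          simp_rw [mul_comm]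
    _ = ∫ x, ∫ z, ρ₀ x * φ (x + Torus.proj (c • z)) ∂stdGaussian (EuclideanSpace ℝ d) :=
          (integral_integral_swap hGi).symm
    _ = ∫ x, ρ₀ x * ∫ z, φ (x + Torus.proj (c • z)) ∂stdGaussian (EuclideanSpace ℝ d) := by
          refine integral_congr_ae (Eventually.of_forall fun x => ?_)
          exact integral_const_mul _ _

/-- The heat solution is continuous in `x`. [folklore] -/
theorem continuous_torusHeatSolution (κ : ℝ) {ρ₀ : UnitAddTorus d → ℝ} (hρ₀ : Continuous ρ₀)
    (τ : ℝ) :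
    Continuous (torusHeatSolution (d := d) κ ρ₀ τ) := by
  obtain ⟨R, hR⟩ := exists_abs_le_of_continuous hρ₀
  have hw : Continuous fun z : EuclideanSpace ℝ d => Torus.proj (Real.sqrt (2 * κ * τ) • z) :=
    Torus.continuous_proj.comp (continuous_const_smul _)
  refine continuous_of_dominated (μ := stdGaussian (EuclideanSpace ℝ d)) (bound := fun _ => R)
    (fun x => ?_) (fun x => ?_) (integrable_const R) (Eventually.of_forall fun z => ?_)
  · exact (hρ₀.comp (continuous_const.sub hw)).aestronglyMeasurable
  · exact Eventually.of_forall fun z => by rw [Real.norm_eq_abs]; exact hR _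
  · exact hρ₀.comp (continuous_id.sub continuous_const)

/-- `|ρ(τ, x)| ≤ R` if `|ρ⁰| ≤ R` (the wrapped heat kernel is a probability measure). [folklore] -/
theorem abs_torusHeatSolution_le (κ : ℝ) {ρ₀ : UnitAddTorus d → ℝ} {R : ℝ} (hR : ∀ x, |ρ₀ x| ≤ R)
    (τ : ℝ) (x : UnitAddTorus d) : |torusHeatSolution (d := d) κ ρ₀ τ x| ≤ R := by
  unfold torusHeatSolution
  calc |∫ z, ρ₀ (x - Torus.proj (Real.sqrt (2 * κ * τ) • z)) ∂stdGaussian (EuclideanSpace ℝ d)|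
        ≤ ∫ z, |ρ₀ (x - Torus.proj (Real.sqrt (2 * κ * τ) • z))|
            ∂stdGaussian (EuclideanSpace ℝ d) :=
          abs_integral_le_integral_abs
    _ ≤ ∫ _z, R ∂stdGaussian (EuclideanSpace ℝ d) :=
          integral_mono_of_nonneg (Eventually.of_forall fun _ => abs_nonneg _)
            (integrable_const R) (Eventually.of_forall fun _ => hR _)
    _ = R := by simp

end Heat

/-! ## The rate of Theorem 2.2 along admissible sequences -/

section Rate

/-- Along `α_k / (log log (N_k+1))^{(A-1)/(2A)} → 0` (and `N_k → ∞`), the right-hand side of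
(2.9) at `t = α_k τ`, `C [α_k τ · α_k / (log log (N_k+1))^{(A-1)/A}]^{A²/(A-1)}`, tends to `0`
(BGSR §6.1.1, (6.1)). [cite: BodineauGallagherSaintRaymondInvent2016, §6.1.1 (6.1)] -/
theorem tendsto_bgsrRate {N : ℕ → ℕ} {α : ℕ → ℝ} {A : ℝ} (C τ : ℝ) (hA : 2 ≤ A)
    (hN : Tendsto (fun k => (N k : ℝ)) atTop atTop)
    (hq : Tendsto (fun k => α k / Real.log (Real.log (N k + 1)) ^ ((A - 1) / (2 * A)))
      atTop (𝓝 0)) :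
    Tendsto (fun k => C * (α k * τ * α k / Real.log (Real.log (N k + 1)) ^ ((A - 1) / A)) ^
      (A ^ 2 / (A - 1))) atTop (𝓝 0) := by
  have hA0 : A ≠ 0 := by positivity
  have hp : 0 < A ^ 2 / (A - 1) := div_pos (by positivity) (by linarith)
  have hL : ∀ᶠ k in atTop, 0 ≤ Real.log (Real.log ((N k : ℝ) + 1)) := by
    have h1 : Tendsto (fun k => Real.log (Real.log ((N k : ℝ) + 1))) atTop atTop :=
      Real.tendsto_log_atTop.comp (Real.tendsto_log_atTop.comp
        (tendsto_atTop_add_const_right _ 1 hN))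
    exact h1.eventually_ge_atTop 0
  have hbase : Tendsto (fun k => τ * (α k / Real.log (Real.log (N k + 1)) ^
      ((A - 1) / (2 * A))) ^ 2) atTop (𝓝 0) := by
    simpa using (hq.pow 2).const_mul τ
  have hr : Tendsto (fun k => C * (τ * (α k / Real.log (Real.log (N k + 1)) ^
      ((A - 1) / (2 * A))) ^ 2) ^ (A ^ 2 / (A - 1))) atTop (𝓝 0) := by
    have := (hbase.rpow_const (Or.inr hp.le)).const_mul C
    simpa [Real.zero_rpow hp.ne'] using this
  refine hr.congr' ?_
  filter_upwards [hL] with k hk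
  congr 2
  set L := Real.log (Real.log ((N k : ℝ) + 1)) with hLdef
  have hL2 : L ^ ((A - 1) / A) = (L ^ ((A - 1) / (2 * A))) ^ 2 := by
    rw [← Real.rpow_natCast (L ^ ((A - 1) / (2 * A))) 2, ← Real.rpow_mul hk]
    congr 1
    push_cast
    field_simp
  rw [hL2, div_pow]
  ring

/-- Along `α_k = (N_k + 1) ε_k^m → ∞` with `0 < ε_k < 1/2`, necessarily `N_k → ∞`. [folklore] -/
theorem tendsto_natCast_of_tendsto_alpha {N : ℕ → ℕ} {ε α : ℕ → ℝ} {m : ℕ}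
    (hε0 : ∀ k, 0 < ε k) (hε1 : ∀ k, ε k < 2⁻¹) (hα : ∀ k, α k = (N k + 1 : ℝ) * ε k ^ m)
    (hαtop : Tendsto α atTop atTop) : Tendsto (fun k => (N k : ℝ)) atTop atTop := by
  refine tendsto_atTop_mono (fun k => ?_) (tendsto_atTop_add_const_right _ (-1) hαtop)
  have hεle : ε k ^ m ≤ 1 :=
    pow_le_one₀ (hε0 k).le (by linarith [hε1 k, (by norm_num : (2⁻¹ : ℝ) < 1)])
  have : α k ≤ (N k : ℝ) + 1 := by
    rw [hα k]
    exact mul_le_of_le_one_right (by positivity) hεle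
  linarith

/-- `log (x + 1) ≤ log x + 1` for `x ≥ 1` (since `x + 1 ≤ 2x ≤ e x`). [folklore] -/
theorem log_add_one_le_log_add_one {x : ℝ} (hx : 1 ≤ x) :
    Real.log (x + 1) ≤ Real.log x + 1 := by
  have hx0 : 0 < x := by linarith
  have he : (2 : ℝ) ≤ Real.exp 1 := by linarith [Real.add_one_le_exp (1 : ℝ)]
  calc Real.log (x + 1) ≤ Real.log (Real.exp 1 * x) := by
        refine Real.log_le_log (by linarith) ?_
        nlinarith
    _ = Real.log x + 1 := by
        rw [Real.log_mul (Real.exp_pos 1).ne' hx0.ne', Real.log_exp]; ring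

/-- The growth hypothesis of the corrected statement implies that of the (deprecated) first
rendering of (d): if `N_k → ∞`, `A ≥ 2` and `α_k / (log log (N_k + 1))^{(A-1)/(2A)} → 0` then
`α_k / √(log log N_k) → 0` (`(A-1)/(2A) < 1/2` and `log log (N+1) ≤ log log N + 1`). [folklore] -/
theorem tendsto_div_sqrt_logLog_of_rate {N : ℕ → ℕ} {α : ℕ → ℝ} {A : ℝ} (hA : 2 ≤ A)
    (hN : Tendsto (fun k => (N k : ℝ)) atTop atTop)
    (hq : Tendsto (fun k => α k / Real.log (Real.log (N k + 1)) ^ ((A - 1) / (2 * A)))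
      atTop (𝓝 0)) :
    Tendsto (fun k => α k / Real.sqrt (Real.log (Real.log (N k)))) atTop (𝓝 0) := by
  set a : ℝ := (A - 1) / (2 * A) with ha
  have ha0 : 0 < a := div_pos (by linarith) (by linarith)
  have ha2 : a < 1 / 2 := by
    rw [ha, div_lt_div_iff₀ (by linarith) two_pos]
    linarith
  have hlogN : Tendsto (fun k => Real.log (N k : ℝ)) atTop atTop := Real.tendsto_log_atTop.comp hN
  have hL : Tendsto (fun k => Real.log (Real.log (N k : ℝ))) atTop atTop :=
    Real.tendsto_log_atTop.comp hlogN
  -- eventually `1 ≤ N_k`, `1 ≤ log N_k`, `1 ≤ log log N_k`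
  have hev : ∀ᶠ k in atTop, (1 : ℝ) ≤ N k ∧ 1 ≤ Real.log (N k : ℝ) ∧
      1 ≤ Real.log (Real.log (N k : ℝ)) := by
    filter_upwards [hN.eventually_ge_atTop 1, hlogN.eventually_ge_atTop 1,
      hL.eventually_ge_atTop 1] with k h1 h2 h3
    exact ⟨h1, h2, h3⟩
  -- comparison `log log N ≤ log log (N+1) ≤ 2 log log N`
  have hcmp : ∀ᶠ k in atTop, Real.log (Real.log (N k : ℝ)) ≤ Real.log (Real.log ((N k : ℝ) + 1)) ∧
      Real.log (Real.log ((N k : ℝ) + 1)) ≤ 2 * Real.log (Real.log (N k : ℝ)) := by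
    filter_upwards [hev] with k ⟨h1, h2, h3⟩
    have hN0 : (0 : ℝ) < N k := by linarith
    have hlogpos : 0 < Real.log (N k : ℝ) := by linarith
    refine ⟨Real.log_le_log hlogpos (Real.log_le_log hN0 (by linarith)), ?_⟩
    calc Real.log (Real.log ((N k : ℝ) + 1)) ≤ Real.log (Real.log (N k : ℝ) + 1) :=
          Real.log_le_log (Real.log_pos (by linarith)) (log_add_one_le_log_add_one h1)
      _ ≤ Real.log (Real.log (N k : ℝ)) + 1 := log_add_one_le_log_add_one h2
      _ ≤ 2 * Real.log (Real.log (N k : ℝ)) := by linarith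
  -- the dominating sequence `2^a (log log N)^{a - 1/2} → 0`
  have hbound : Tendsto (fun k => (2 : ℝ) ^ a * Real.log (Real.log (N k : ℝ)) ^ (a - 1 / 2))
      atTop (𝓝 0) := by
    have h1 := ((tendsto_rpow_neg_atTop (by linarith : (0 : ℝ) < 1 / 2 - a)).comp hL).const_mul
      ((2 : ℝ) ^ a)
    rw [mul_zero] at h1
    refine h1.congr' (Eventually.of_forall fun k => ?_)
    simp only [Function.comp_apply, neg_sub]
  -- the ratio `(log log (N+1))^a / √(log log N) → 0`
  have hratio : Tendsto (fun k => Real.log (Real.log ((N k : ℝ) + 1)) ^ a /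
      Real.sqrt (Real.log (Real.log (N k : ℝ)))) atTop (𝓝 0) := by
    refine squeeze_zero' ?_ ?_ hbound
    · filter_upwards [hcmp, hev] with k ⟨hc1, hc2⟩ ⟨_, _, h3⟩
      exact div_nonneg (Real.rpow_nonneg (by linarith) _) (Real.sqrt_nonneg _)
    · filter_upwards [hcmp, hev] with k ⟨hc1, hc2⟩ ⟨_, _, h3⟩
      have hLpos : 0 < Real.log (Real.log (N k : ℝ)) := by linarith
      rw [Real.sqrt_eq_rpow, div_le_iff₀ (Real.rpow_pos_of_pos hLpos _)]
      calc Real.log (Real.log ((N k : ℝ) + 1)) ^ a ≤ (2 * Real.log (Real.log (N k : ℝ))) ^ a :=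
            Real.rpow_le_rpow (by linarith) hc2 ha0.le
        _ = (2 : ℝ) ^ a * Real.log (Real.log (N k : ℝ)) ^ (a - 1 / 2) *
            Real.log (Real.log (N k : ℝ)) ^ (1 / 2 : ℝ) := by
            rw [Real.mul_rpow (by norm_num) hLpos.le, mul_assoc, ← Real.rpow_add hLpos]
            congr 2
            ring
  -- `α/√(log log N) = (α / (log log (N+1))^a) · ((log log (N+1))^a / √(log log N))`
  have hprod := hq.mul hratio
  rw [mul_zero] at hprod
  refine hprod.congr' ?_
  filter_upwards [hcmp, hev] with k ⟨hc1, hc2⟩ ⟨_, _, h3⟩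
  have hL'pos : 0 < Real.log (Real.log ((N k : ℝ) + 1)) := by linarith
  have hx : Real.log (Real.log ((N k : ℝ) + 1)) ^ a ≠ 0 := (Real.rpow_pos_of_pos hL'pos a).ne'
  rw [div_mul_div_comm, mul_comm (α k), mul_div_mul_left _ _ hx]

end Rate

/-! ## Assembly: Theorem 2.3 (one-time marginals) from the printed intermediate results -/

section Assembly

variable {ε β : ℝ} {N : ℕ}

/-- **The law of the tagged position against a test function** (BGSR (2.10), position
marginal): `∫ φ dLaw(x_1(t)) = ∫∫ f_N^{(1)}(t, x, v) φ(x) dx dv`, from the sibling file's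
identification of the tagged law with `f_N^{(1)} dx dv`
(`integral_taggedLaw_eq_integral_bgsrTaggedMarginal`).
[cite: BodineauGallagherSaintRaymondInvent2016, (2.10)] -/
theorem integral_taggedPositionLaw_eq (hβ : 0 < β) {ρ₀ : UnitAddTorus d → ℝ} (hρ₀ : Measurable ρ₀)
    (hρ₀0 : ∀ x, 0 ≤ ρ₀ x) {R : ℝ} (hR : ∀ x, ρ₀ x ≤ R)
    (Φ : HardSphereFlow (Torus.geometry d) ε (N + 1)) (t : ℝ) {φ : UnitAddTorus d → ℝ}
    (hφ : Continuous φ) :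
    ∫ x, φ x ∂Literature.Analysis.FunctionSpaces.taggedPositionLaw Φ
        (Literature.Analysis.FunctionSpaces.equilibriumTaggedDensity (Torus.geometry d) ε N β fun z => ρ₀ z.1) t =
      ∫ z : UnitAddTorus d × EuclideanSpace ℝ d, bgsrTaggedMarginal Φ β ρ₀ t z.1 z.2 * φ z.1 := by
  rw [Literature.Analysis.FunctionSpaces.taggedPositionLaw_eq,
    integral_map measurable_fst.aemeasurable hφ.aestronglyMeasurable]
  exact integral_taggedLaw_eq_integral_bgsrTaggedMarginal hβ hρ₀ hρ₀0 hR Φ t fun z => φ z.1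

/-- **BGSR Theorem 2.3 assembled** (arXiv:1305.3397v2 §6.1.1: "Then (2.12) follows directly from
the following result [(6.3)]", given (6.1), i.e. (2.9) at `t = ατ`): the corrected one-time
statement `bodineau_gallagher_saintRaymond_diffusive` follows from Theorem 2.2
(`bgsr_linearBoltzmannApprox`), Lemma 6.1/(6.5) (`bgsr_exists_diffusionCorrector`), the
positivity of `κ_β` (`bgsr_diffusionCoeff_pos`) and the hydrodynamic limit (6.3)
(`bgsr_hydrodynamicLimit`), with `κ = 2κ_β`. In between: the law of `x_1(α τ)` tested against
`φ` is `∫∫ f_N^{(1)}(ατ, x, v) φ(x)`; the `L^∞` bounds (6.1) (whose right-hand side tends to `0`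
along the admissible sequence, `tendsto_bgsrRate`) and (6.3) give `f_N^{(1)}(α_k τ) → M_β ρ(τ)`
uniformly a.e.; the domination `f_N^{(1)} ≤ ‖ρ⁰‖_∞ M_β` (Prop. 4.1) allows dominated
convergence; and `∫ φ ρ(τ) = ∫ ρ⁰ · (G_{2κ_β τ} * φ)`.
[cite: BodineauGallagherSaintRaymondInvent2016, Thm. 2.3 and §6.1.1] -/
theorem bodineau_gallagher_saintRaymond_diffusive_of_facts
    (h₁ : bgsr_linearBoltzmannApprox (d := d)) (h₂ : bgsr_exists_diffusionCorrector (d := d))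
    (h₃ : bgsr_diffusionCoeff_pos (d := d)) (h₄ : bgsr_hydrodynamicLimit (d := d)) :
    bodineau_gallagher_saintRaymond_diffusive (d := d) := by
  intro hd β hβ
  obtain ⟨⟨b, hb⟩, -⟩ := h₂ hd hβ
  have hκ : 0 < bgsrDiffusionCoeff β b := h₃ hd hβ b hb
  refine ⟨2 * bgsrDiffusionCoeff β b, by positivity, ?_⟩
  intro N ε α hε0 hε1 hα hαtop hrate ρ₀ hρ₀c hρ₀0 hρ₀1 Φ τ hτ φ hφc
  obtain ⟨A, hA, hq⟩ := hrate
  obtain ⟨R, hR⟩ := exists_abs_le_of_continuous hρ₀c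
  have hR0 : 0 ≤ R := (abs_nonneg _).trans (hR 0)
  have hRle : ∀ x, ρ₀ x ≤ R := fun x => (le_abs_self _).trans (hR x)
  obtain ⟨C, hC, N₀, hmain⟩ := h₁ hd hβ hA hR0
  obtain ⟨B, hB⟩ := exists_abs_le_of_continuous hφc
  have hN : Tendsto (fun k => (N k : ℝ)) atTop atTop :=
    tendsto_natCast_of_tendsto_alpha hε0 hε1 hα hαtop
  -- the limit density `M_β(v) ρ(τ, x)`
  set ρ : UnitAddTorus d → ℝ := torusHeatSolution (bgsrDiffusionCoeff β b) ρ₀ τ with hρdef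
  have hρc : Continuous ρ := continuous_torusHeatSolution _ hρ₀c τ
  -- Step 1: the law of `x_1(α_k τ)` tested against `φ`
  have h_eq : ∀ k, ∫ x, φ x ∂Literature.Analysis.FunctionSpaces.taggedPositionLaw (Φ k)
      (Literature.Analysis.FunctionSpaces.equilibriumTaggedDensity (Torus.geometry d) (ε k) (N k) β fun z => ρ₀ z.1)
        (α k * τ) =
      ∫ z : UnitAddTorus d × EuclideanSpace ℝ d,
        bgsrTaggedMarginal (Φ k) β ρ₀ (α k * τ) z.1 z.2 * φ z.1 := fun k =>
    integral_taggedPositionLaw_eq hβ hρ₀c.measurable hρ₀0 hRle (Φ k) _ hφc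
  simp_rw [h_eq]
  -- Step 2: a.e.-uniform closeness `|f^{(1)}(α_k τ) - M_β ρ(τ)| ≤ e` eventually: (6.1) + (6.3)
  have hle : ∀ e : ℝ, 0 < e → ∀ᶠ k in atTop, ∀ᵐ z : UnitAddTorus d × EuclideanSpace ℝ d,
      |bgsrTaggedMarginal (Φ k) β ρ₀ (α k * τ) z.1 z.2 -
        Literature.Analysis.FunctionSpaces.maxwellianBeta β z.2 * ρ z.1| ≤ e := by
    intro e he
    obtain ⟨α₀, hα₀⟩ := h₄ hd hβ b hb ρ₀ hρ₀c hρ₀0 hρ₀1 hτ (half_pos he)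
    have hr := tendsto_bgsrRate C τ hA hN hq
    have hL : ∀ᶠ k in atTop, 0 ≤ Real.log (Real.log ((N k : ℝ) + 1)) :=
      (Real.tendsto_log_atTop.comp (Real.tendsto_log_atTop.comp
        (tendsto_atTop_add_const_right _ 1 hN))).eventually_ge_atTop 0
    filter_upwards [hN.eventually_ge_atTop (N₀ : ℝ), hαtop.eventually_gt_atTop 1,
      (hαtop.atTop_mul_const hτ).eventually_gt_atTop 1, hαtop.eventually_ge_atTop α₀,
      hr.eventually (ge_mem_nhds (half_pos he)), hL] with k hkN hkα hkατ hkα₀ hkr hkL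
    have hkN' : N₀ ≤ N k := Nat.cast_le.1 hkN
    have hkα' : 1 < ((N k : ℝ) + 1) * ε k ^ (Fintype.card d - 1) := by rwa [← hα k]
    obtain ⟨φk, hsol, hest⟩ := hmain (N k) hkN' (ε k) (hε0 k) (hε1 k) hkα' ρ₀ hρ₀c hρ₀0
      hRle hρ₀1 (Φ k)
    rw [← hα k] at hsol hest
    have hr0 : 0 ≤ C * (α k * τ * α k / Real.log (Real.log ((N k : ℝ) + 1)) ^ ((A - 1) / A)) ^
        (A ^ 2 / (A - 1)) :=
      mul_nonneg hC.le (Real.rpow_nonneg (div_nonneg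
        (mul_nonneg (mul_nonneg (by linarith) hτ.le) (by linarith)) (Real.rpow_nonneg hkL _)) _)
    have hae := ae_abs_le_of_eLpNorm_top_le hr0 (hest (α k * τ) hkατ)
    have hhyd := hα₀ (α k) hkα₀ φk hsol τ ⟨hτ.le, le_rfl⟩
    filter_upwards [hae] with z hz
    have h2 : |Literature.Analysis.FunctionSpaces.maxwellianBeta β z.2 * φk (α k * τ) z.1 z.2 -
        Literature.Analysis.FunctionSpaces.maxwellianBeta β z.2 * ρ z.1| ≤ e / 2 := by
      rw [← mul_sub, abs_mul, abs_of_pos (Literature.Analysis.FunctionSpaces.maxwellianBeta_pos hβ _)]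
      exact hhyd z.1 z.2
    calc |bgsrTaggedMarginal (Φ k) β ρ₀ (α k * τ) z.1 z.2 - Literature.Analysis.FunctionSpaces.maxwellianBeta β z.2 * ρ z.1|
        ≤ |bgsrTaggedMarginal (Φ k) β ρ₀ (α k * τ) z.1 z.2 -
            Literature.Analysis.FunctionSpaces.maxwellianBeta β z.2 * φk (α k * τ) z.1 z.2| +
          |Literature.Analysis.FunctionSpaces.maxwellianBeta β z.2 * φk (α k * τ) z.1 z.2 -
            Literature.Analysis.FunctionSpaces.maxwellianBeta β z.2 * ρ z.1| := abs_sub_le _ _ _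
      _ ≤ e / 2 + e / 2 := add_le_add (hz.trans hkr) h2
      _ = e := by ring
  -- Step 3: dominated convergence with the Maxwellian majorant of Prop. 4.1
  have hlim := tendsto_integral_mul_of_maxwellian_dominated hβ
    (fun k z => bgsrTaggedMarginal (Φ k) β ρ₀ (α k * τ) z.1 z.2)
    (fun z => Literature.Analysis.FunctionSpaces.maxwellianBeta β z.2 * ρ z.1)
    (fun k => measurable_bgsrTaggedMarginal hρ₀c.measurable (Φ k) β _)
    (((continuous_maxwellianBeta β).comp continuous_snd).mul (hρc.comp continuous_fst))
    (R := R) (fun z => by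
      rw [abs_mul, abs_of_pos (Literature.Analysis.FunctionSpaces.maxwellianBeta_pos hβ _), mul_comm]
      exact mul_le_mul_of_nonneg_right (abs_torusHeatSolution_le _ hR τ z.1)
        (Literature.Analysis.FunctionSpaces.maxwellianBeta_pos hβ _).le)
    (C := R) (Eventually.of_forall fun k z => by
      rw [abs_of_nonneg (bgsrTaggedMarginal_nonneg hβ hρ₀0 (Φ k) _ z.1 z.2)]
      exact bgsrTaggedMarginal_le hβ hρ₀0 hRle (Φ k) _ z.1 z.2)
    hle (fun z => φ z.1) hφc.fst' ⟨B, fun z => hB z.1⟩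
  -- Step 4: the limit `∫∫ φ(x) M_β(v) ρ(τ, x) = ∫ ρ⁰ · (G_{2κ_β τ} * φ)`
  have hrhs : ∫ x, ∫ v : EuclideanSpace ℝ d, φ x * (Literature.Analysis.FunctionSpaces.maxwellianBeta β v * ρ x) =
      ∫ x, ρ₀ x * ∫ z, φ ((Torus.geometry d).translate x
        (Real.sqrt (2 * bgsrDiffusionCoeff β b * τ) • z)) ∂stdGaussian (EuclideanSpace ℝ d) := by
    have h1 : ∀ x, ∫ v : EuclideanSpace ℝ d, φ x * (Literature.Analysis.FunctionSpaces.maxwellianBeta β v * ρ x) = φ x * ρ x :=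
        fun x => by
      rw [show (fun v : EuclideanSpace ℝ d => φ x * (Literature.Analysis.FunctionSpaces.maxwellianBeta β v * ρ x)) =
          fun v => φ x * ρ x * Literature.Analysis.FunctionSpaces.maxwellianBeta β v from funext fun v => by ring,
        integral_const_mul, integral_maxwellianBeta hβ, mul_one]
    simp_rw [h1]
    rw [hρdef, integral_mul_torusHeatSolution _ hρ₀c hφc τ]
    simp only [Torus.geometry_translate]
  rw [← hrhs]
  exact hlim

end Assembly

/-- **BGSR Theorem 2.3 (one-time marginals) from Theorem 2.2, Lemma 6.1/(6.5) and (6.3)**: as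
`bodineau_gallagher_saintRaymond_diffusive_of_facts`, with the positivity of `κ_β`
(`bgsr_diffusionCoeff_pos`) supplied by Part I (`bgsr_diffusionCoeff_pos_holds`).
[cite: BodineauGallagherSaintRaymondInvent2016, Thm. 2.3 and §6.1.1] -/
theorem bodineau_gallagher_saintRaymond_diffusive_of_facts'
    (h₁ : bgsr_linearBoltzmannApprox (d := d)) (h₂ : bgsr_exists_diffusionCorrector (d := d))
    (h₄ : bgsr_hydrodynamicLimit (d := d)) :
    bodineau_gallagher_saintRaymond_diffusive (d := d) :=
  bodineau_gallagher_saintRaymond_diffusive_of_facts h₁ h₂ bgsr_diffusionCoeff_pos_holds h₄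

end

end Literature.MathematicalPhysics.KineticTheory
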